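import Mathlib.Data.ZMod.Basic
import Mathlib.Algebra.CharP.Two
import Literature.Computability.Complexity.RegularWalks
import Literature.ModelTheory.FiniteModelTheory.CkEquiv
import HarnessLib

/-!
# Tseitin 3-colouring graphs over a rotation map and Duplicator's strategy from local consistency

Topic `Literature/ModelTheory/FiniteModelTheory`; support file for the discharge of the named fact
`AtseriasDawarOchremiak2021_threeColourability_countingWidth` (`CountingWidth.lean`: linear counting width
of 3-colourability, Atserias–Dawar–Ochremiak 2021, §5.2, Lemma 13 of arXiv:1901.07825), completed in
`CountingWidthProofs.lean`. Everything here is PROVED; there are no named facts.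

The printed proof of Lemma 13 composes (i) the linear lower bound for 3-XOR (Theorem 3 of the source =
Atserias–Dawar 2019, Thm 3.7: the parity system of an expander, satisfiable vs. unsatisfiable right-hand
sides, is `≡^{C^{Ω(n)}}`-indistinguishable; mechanism: Duplicator's strategy in the bijective game from a
family of locally consistent partial assignments, Atserias–Dawar 2019, Lemma 3.2 = Lemma 2 of
arXiv:1806.11307, going back to Cai–Fürer–Immerman 1992, §6) with (ii) the textbook 3-SAT → 3-colouring
gadget reduction as a quantifier-free interpretation (the source cites Papadimitriou 1994, §9.3). This file carries out (i)
and (ii) FUSED: the 3-colouring encoding is built directly over the parity system and Duplicator's strategy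
is played directly on the encoded graphs (so no general interpretation lemma is needed).

## Content

* `TseitinColouring.graph R c` — for a `d`-regular rotation map `R : RotGraph m d` (the tree's
  `Expander.RotGraph`: darts `(v, i)`, involution `rot`) and CHARGES `c : Fin m → ZMod 2`, the 3-COLOURING
  ENCODING `H(R, c)` of the parity system "`∑_{i} x_{(v,i)} = c v` for every vertex `v`, `x_δ = x_{rot δ}`,
  `x_δ = 0` on half-edges" on the uniform vertex type `Vert m d`: VALUE vertices `(δ, a)` (literal
  "`x_δ = a`"), CLAUSE GADGETS `(w, ρ, i, j)` — the clause "`x|_w ≠ ρ`" as a chain of `d - 1` OR-gadgets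
  (the textbook six-vertex OR-gadget `u, u', o` per position, iterated), ACTIVE iff `∑ ρ ≠ c w` — and a palette triangle.
* `shift v` (`v : Dart → ZMod 2` constant on edges): an involution of `Vert m d` which is an ISOMORPHISM
  `H(R, c) ≅ H(R, c + ∂v)` (`graph_adj_shift_iff`; the CFI "flip"), and `graph_adj_congr` (charges only
  matter at the gadgets they charge).
* `colorable_zero : H(R, 0)` is 3-colourable (explicit colouring); `not_colorable_of_sum_ne_zero`: for
  `d ≥ 2` and `∑ c ≠ 0` it is not (a colouring yields an assignment satisfying every parity constraint —
  the OR-chains force each clause — and the constraints sum to `∑_δ x_δ = 0` by the dart involution).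
* TERRITORY GRAPHS `terr R D` (unblocked darts), components `comp`, `EdgeExpansion R η` (the shape of
  `Expander.Family.edgeExpansion_X`), `exists_big` (fewer than `η m` blocked darts leave a component with
  more than `m/2` vertices — sum the expansion inequality over all components), LOCAL CONSISTENCY
  `LocCons c D v` (every small component has even total charge `∑ (c + ∂v)`), preserved under restriction
  (`locCons_restrict`) and extendable one edge at a time below the budget (`locCons_extend`: choose the new
  value to fix the parity of the small side of a split component; both sides small is excluded by
  `exists_big`) — i.e. the parity system of an edge expander is `Ω(m)`-locally satisfiable for EVERY `c`.
* `ckEquiv_graph`: **Duplicator wins the bijective `K`-pebble game on `H(R, c)` and `H(R, 0)` whenever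
  `2dK < η m`** — positions: pebble pairs `(x, shift v x)` for a locally consistent `v` on the darts needed by
  the pebbled vertices; bijection: shift every vertex by a consistent extension of `v` to its own needed
  darts (Atserias–Dawar 2019, proof of Lemma 3.2: "the bijection taking `x_l^a` to `x_l^{a+f(x_l)}`").
* `per d`, `card_vert`: `|Vert m d| = m · per d + 3`.

## References

* A. Atserias, A. Dawar, J. Ochremiak, *On the power of symmetric linear programs*, J. ACM 68 (2021)
  Art. 26 = LICS 2019, arXiv:1901.07825, §5.2, Theorem 3 and Lemma 13 with its proof. Read: arXiv pp. 21–22.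
* A. Atserias, A. Dawar, *Definable inapproximability: new challenges for duplicator*, J. Log. Comput. 29
  (2019), arXiv:1806.11307, §3.2, Lemma 3.2 (= Lemma 2) and its proof (the strategy from local
  satisfiability), Thm 3.7. Read: arXiv pp. 9–13.
* J.-Y. Cai, M. Fürer, N. Immerman, *An optimal lower bound on the number of variables for graph
  identification*, Combinatorica 12 (1992), §6 (gadgets, straight/twisted links, the flip argument).
* C. H. Papadimitriou, *Computational Complexity* (1994), §9.3 (3-COLORING is NP-complete, via NAESAT; the
  source's "[PapadimitriouBook]"; here the generic OR-gadget starting from clauses of any width is used).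

## Design notes

* Charges enter ONLY through activity of gadgets, on a vertex type independent of `c`; inactive gadgets are
  isolated vertices. Hence shifts are global involutions and the two compared graphs share their vertex type.
* Half-edges (`rot δ = δ`, present in the contracted expanders `Expander.Family.X`) are neutralised by forcing
  `x_δ = 0`; self-loops contribute `x + x = 0`; the unsatisfiability argument is `Finset.sum_involution`.
* NOT here: the instantiation with the explicit expanders, the padding to every order and the constants —
  `CountingWidthProofs.lean`.
-/

namespace Literature.ModelTheory.FiniteModelTheory

open Finset
open Literature.Computability.Complexity.Expander (RotGraph)

namespace TseitinColouring

variable {m d : ℕ}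

/-- Darts of a `d`-regular rotation map on `Fin m`. [folklore] -/
abbrev Dart (m d : ℕ) : Type := Fin m × Fin d

/-- Gadget vertices: `(w, ρ, i, j)` = node `j` (0 = `u`, 1 = `u'`, 2 = `o`) of OR-position `i` of the
clause gadget `(w, ρ)`. [folklore] -/
abbrev GVert (m d : ℕ) : Type := Fin m × (Fin d → ZMod 2) × Fin d × Fin 3

/-- The uniform vertex type: value vertices `(δ, a)`, gadget vertices, three palette vertices. [folklore] -/
abbrev Vert (m d : ℕ) : Type := (Dart m d × ZMod 2) ⊕ GVert m d ⊕ Fin 3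

/-- The clause gadget `(w, ρ)` is ACTIVE for the charges `c` when `∑ ρ ≠ c w`. [folklore] -/
def Active (c : Fin m → ZMod 2) (w : Fin m) (ρ : Fin d → ZMod 2) : Prop := (∑ i, ρ i) ≠ c w

/-- Activity of a clause gadget is decidable. [folklore] -/
instance (c : Fin m → ZMod 2) (w : Fin m) (ρ : Fin d → ZMod 2) : Decidable (Active c w ρ) := by
  unfold Active; infer_instance

/-- The `i`-th literal vertex of clause `(w, ρ)`: the value vertex `((w, i), ρ i + 1)`. [folklore] -/
def lit (w : Fin m) (ρ : Fin d → ZMod 2) (i : Fin d) : Dart m d × ZMod 2 := ((w, i), ρ i + 1)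

variable (R : RotGraph m d)

/-- Generating (directed) adjacency of the Tseitin 3-colouring graph with charges `c`. [folklore] -/
def hrel (c : Fin m → ZMod 2) : Vert m d → Vert m d → Prop
  | .inl (δ, a), .inl (δ', a') => (δ' = δ ∨ δ' = R.rot δ) ∧ a' = a + 1
  | .inl (δ, a), .inr (.inr t) => t = 2 ∨ (t = 0 ∧ a = 1 ∧ R.rot δ = δ)
  | .inr (.inl (w, ρ, i, j)), .inr (.inl (w', ρ', i', j')) =>
      w' = w ∧ ρ' = ρ ∧ Active c w ρ ∧ 1 ≤ i.val ∧
        ((i' = i ∧ ((j = 0 ∧ j' = 1) ∨ (j = 0 ∧ j' = 2) ∨ (j = 1 ∧ j' = 2))) ∨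
          (i'.val = i.val + 1 ∧ j = 2 ∧ j' = 0))
  | .inr (.inl (w, ρ, i, j)), .inl x =>
      Active c w ρ ∧ 1 ≤ i.val ∧
        ((j = 0 ∧ i.val = 1 ∧ x = lit w ρ ⟨0, i.pos⟩) ∨ (j = 1 ∧ x = lit w ρ i))
  | .inr (.inl (w, ρ, i, j)), .inr (.inr t) =>
      Active c w ρ ∧ 1 ≤ i.val ∧ j = 2 ∧ (t = 2 ∨ (t = 1 ∧ i.val + 1 = d))
  | .inr (.inr t), .inr (.inr t') => t ≠ t'
  | _, _ => False

/-- **The Tseitin 3-colouring graph** `H(R, c)`. [folklore] -/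
def graph (c : Fin m → ZMod 2) : SimpleGraph (Vert m d) := SimpleGraph.fromRel (hrel R c)

/-! ### Shifts -/

/-- The shift of the vertex set by a dart function `v`. [folklore] -/
def shift (v : Dart m d → ZMod 2) : Vert m d → Vert m d
  | .inl (δ, a) => .inl (δ, a + v δ)
  | .inr (.inl (w, ρ, i, j)) => .inr (.inl (w, ρ + fun i => v (w, i), i, j))
  | .inr (.inr t) => .inr (.inr t)

/-- Boundary (vertex sums) of a dart function. [folklore] -/
def bd (v : Dart m d → ZMod 2) : Fin m → ZMod 2 := fun w => ∑ i, v (w, i)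

/-- `a + a = 0` in `ZMod 2`. [folklore] -/
private theorem zmod2_add_self (a : ZMod 2) : a + a = 0 := by
  have := CharTwo.add_self_eq_zero a
  exact this

/-- Shifting twice by the same dart function is the identity (characteristic two). [folklore] -/
theorem shift_shift (v : Dart m d → ZMod 2) (x : Vert m d) : shift v (shift v x) = x := by
  rcases x with ⟨δ, a⟩ | ⟨w, ρ, i, j⟩ | t
  · simp [shift, add_assoc, zmod2_add_self]
  · simp only [shift, Sum.inr.injEq, Sum.inl.injEq, Prod.mk.injEq, and_true, true_and]
    funext i
    simp [add_assoc, zmod2_add_self]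
  · rfl

/-- The shift is an involution. [folklore] -/
theorem shift_involutive (v : Dart m d → ZMod 2) : Function.Involutive (shift (m := m) (d := d) v) :=
  shift_shift v

/-- The shift as a permutation of the vertex set. [folklore] -/
def shiftEquiv (v : Dart m d → ZMod 2) : Vert m d ≃ Vert m d :=
  Function.Involutive.toPerm (shift v) (shift_involutive v)

/-- The shift permutation acts by `shift`. [folklore] -/
@[simp] theorem shiftEquiv_apply (v : Dart m d → ZMod 2) (x : Vert m d) : shiftEquiv v x = shift v x := rfl

/-- Admissible dart functions: constant on each edge, zero on half-edges (fixed darts). [folklore] -/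
structure Adm (v : Dart m d → ZMod 2) : Prop where
  rot_eq : ∀ δ, v (R.rot δ) = v δ
  fixed : ∀ δ, R.rot δ = δ → v δ = 0

/-- Activity of a gadget is transported by the shift to the shifted charges `c + ∂v`. [folklore] -/
theorem active_shift_iff (c : Fin m → ZMod 2) (v : Dart m d → ZMod 2) (w : Fin m) (ρ : Fin d → ZMod 2) :
    Active (c + bd v) w (ρ + fun i => v (w, i)) ↔ Active c w ρ := by
  unfold Active bd
  simp only [Pi.add_apply, Finset.sum_add_distrib]
  exact (add_left_inj _).not

/-- The literal vertices of a shifted clause. [folklore] -/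
theorem lit_shift (v : Dart m d → ZMod 2) (w : Fin m) (ρ : Fin d → ZMod 2) (i : Fin d) :
    lit w (ρ + fun i => v (w, i)) i = ((w, i), ρ i + 1 + v (w, i)) := by
  simp [lit, add_comm, add_left_comm, add_assoc]

/-- The shift by an admissible `v` transports `hrel c` to `hrel (c + bd v)`. [folklore] -/
theorem hrel_shift_iff {v : Dart m d → ZMod 2} (hv : Adm R v) (c : Fin m → ZMod 2) (x y : Vert m d) :
    hrel R (c + bd v) (shift v x) (shift v y) ↔ hrel R c x y := by
  rcases x with ⟨δ, a⟩ | ⟨w, ρ, i, j⟩ | t <;> rcases y with ⟨δ', a'⟩ | ⟨w', ρ', i', j'⟩ | t'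
  · -- value / value
    simp only [shift, hrel]
    have hvv : (δ' = δ ∨ δ' = R.rot δ) → v δ' = v δ := by
      rintro (rfl | rfl)
      · rfl
      · exact hv.rot_eq δ
    constructor
    · rintro ⟨hδ, ha⟩
      refine ⟨hδ, ?_⟩
      rw [hvv hδ, add_right_comm] at ha
      exact add_right_cancel ha
    · rintro ⟨hδ, rfl⟩
      refine ⟨hδ, ?_⟩
      rw [hvv hδ, add_right_comm]
  · simp [shift, hrel]
  · -- value / palette
    simp only [shift, hrel]
    constructor
    · rintro (h | ⟨ht, ha, hfix⟩)
      · exact Or.inl h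
      · refine Or.inr ⟨ht, ?_, hfix⟩
        rw [hv.fixed δ hfix, add_zero] at ha; exact ha
    · rintro (h | ⟨ht, ha, hfix⟩)
      · exact Or.inl h
      · refine Or.inr ⟨ht, ?_, hfix⟩
        rw [hv.fixed δ hfix, add_zero]; exact ha
  · -- gadget / value
    simp only [shift, hrel, active_shift_iff, lit_shift]
    have key : ∀ (i₀ : Fin d), ((δ', a' + v δ') = ((w, i₀), ρ i₀ + 1 + v (w, i₀))) ↔
        ((δ', a') = lit w ρ i₀) := by
      intro i₀
      simp only [lit, Prod.mk.injEq]
      constructor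
      · rintro ⟨rfl, h⟩
        exact ⟨rfl, add_right_cancel h⟩
      · rintro ⟨rfl, rfl⟩
        exact ⟨rfl, rfl⟩
    rw [key, key]
  · -- gadget / gadget
    simp only [shift, hrel, active_shift_iff]
    constructor
    · rintro ⟨hw, hρ, hact, hi, hrest⟩
      subst w'
      refine ⟨rfl, ?_, hact, hi, hrest⟩
      funext k
      have hk := congrFun hρ k
      simp only [Pi.add_apply] at hk
      exact add_right_cancel hk
    · rintro ⟨hw, hρ, hact, hi, hrest⟩
      subst w'
      subst ρ'
      exact ⟨rfl, rfl, hact, hi, hrest⟩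
  · -- gadget / palette
    simp only [shift, hrel, active_shift_iff]
  · simp [shift, hrel]
  · simp [shift, hrel]
  · simp [shift, hrel]

/-- Hence the shift is an isomorphism `H(R, c) ≃g H(R, c + bd v)`. [folklore] -/
theorem graph_adj_shift_iff {v : Dart m d → ZMod 2} (hv : Adm R v) (c : Fin m → ZMod 2) (x y : Vert m d) :
    (graph R (c + bd v)).Adj (shift v x) (shift v y) ↔ (graph R c).Adj x y := by
  simp only [graph, SimpleGraph.fromRel_adj, ne_eq, (shift_involutive v).injective.eq_iff,
    hrel_shift_iff R hv]

/-! ### Agreement of two charge functions away from the charged gadgets -/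

/-- `x` does not see the difference between the charges `c` and `c'`. [folklore] -/
def Agrees (c c' : Fin m → ZMod 2) : Vert m d → Prop
  | .inr (.inl (w, _, _, _)) => c w = c' w
  | _ => True

/-- Activity at `w` only depends on the charge at `w`. [folklore] -/
theorem active_congr {c c' : Fin m → ZMod 2} {w : Fin m} (h : c w = c' w) (ρ : Fin d → ZMod 2) :
    Active c w ρ ↔ Active c' w ρ := by unfold Active; rw [h]

/-- Two charge functions agreeing at the gadgets of `x` and `y` generate the same adjacency between them. [folklore] -/
theorem hrel_congr {c c' : Fin m → ZMod 2} {x y : Vert m d} (hx : Agrees c c' x) (hy : Agrees c c' y) :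
    hrel R c x y ↔ hrel R c' x y := by
  rcases x with ⟨δ, a⟩ | ⟨w, ρ, i, j⟩ | t <;> rcases y with ⟨δ', a'⟩ | ⟨w', ρ', i', j'⟩ | t' <;>
    simp only [hrel, Agrees] at hx hy ⊢
  · rw [active_congr hx]
  · rw [active_congr hx]
  · rw [active_congr hx]

/-- Two charge functions agreeing at the gadgets of `x` and `y` give the same adjacency between them. [folklore] -/
theorem graph_adj_congr {c c' : Fin m → ZMod 2} {x y : Vert m d} (hx : Agrees c c' x) (hy : Agrees c c' y) :
    (graph R c).Adj x y ↔ (graph R c').Adj x y := by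
  simp only [graph, SimpleGraph.fromRel_adj, hrel_congr R hx hy, hrel_congr R hy hx]

end TseitinColouring

end Literature.ModelTheory.FiniteModelTheory

namespace Literature.ModelTheory.FiniteModelTheory.TseitinColouring

open Finset
open Literature.Computability.Complexity.Expander (RotGraph)

variable {m d : ℕ} (R : RotGraph m d)

/-! ### Small facts about `ZMod 2` and `Fin 3` -/

/-- Case analysis in `ZMod 2`. [folklore] -/
private theorem zmod2_eq_zero_or_one (a : ZMod 2) : a = 0 ∨ a = 1 := by revert a; decide

/-- In `ZMod 2`, `a ≠ 0 ↔ a = 1`. [folklore] -/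
private theorem zmod2_ne_zero_iff (a : ZMod 2) : a ≠ 0 ↔ a = 1 := by revert a; decide

/-- In `ZMod 2`, `a + 1 = 0 ↔ a = 1`. [folklore] -/
private theorem zmod2_add_one_eq_zero_iff (a : ZMod 2) : a + 1 = 0 ↔ a = 1 := by revert a; decide

/-- In `ZMod 2`, `a + 1 ≠ a`. [folklore] -/
private theorem zmod2_add_one_ne (a : ZMod 2) : a + 1 ≠ a := by revert a; decide

/-- In `ZMod 2`, `a ≠ b + 1` forces `a = b`. [folklore] -/
private theorem zmod2_eq_of_ne_add_one {a b : ZMod 2} (h : a ≠ b + 1) : a = b := by revert a b; decide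

/-- Three distinct elements exhaust `Fin 3`. [folklore] -/
private theorem fin3_cases {t f b : Fin 3} (htf : t ≠ f) (htb : t ≠ b) (hfb : f ≠ b) (x : Fin 3) :
    x = t ∨ x = f ∨ x = b := by revert t f b x; decide

/-- The OR-gadget: if both inputs have the colour `f` then so does the output. [folklore] -/
private theorem fin3_or_gadget {t f b : Fin 3} (htf : t ≠ f) (htb : t ≠ b) (hfb : f ≠ b) {u u' o : Fin 3}
    (hu : u ≠ f) (hu' : u' ≠ f) (huu' : u ≠ u') (hou : o ≠ u) (hou' : o ≠ u') (hob : o ≠ b) : o = f := by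
  revert t f b u u' o; decide

/-! ### Adjacencies of `H(R, c)` -/

section adj

variable {R} {c : Fin m → ZMod 2}

/-- A generating pair of distinct vertices is an edge of `H(R, c)`. [folklore] -/
theorem adj_of_hrel {x y : Vert m d} (hne : x ≠ y) (h : hrel R c x y) : (graph R c).Adj x y := by
  rw [graph, SimpleGraph.fromRel_adj]; exact ⟨hne, Or.inl h⟩

/-- The palette is a triangle. [folklore] -/
theorem adj_pal {t t' : Fin 3} (h : t ≠ t') : (graph R c).Adj (.inr (.inr t)) (.inr (.inr t')) :=
  adj_of_hrel (by simpa using h) (by simp [hrel, h])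

/-- Every value vertex is joined to the base colour `2`. [folklore] -/
theorem adj_val_base (δ : Dart m d) (a : ZMod 2) : (graph R c).Adj (.inl (δ, a)) (.inr (.inr 2)) :=
  adj_of_hrel (by simp) (by simp [hrel])

/-- The two value vertices of a dart are joined (complementary literals). [folklore] -/
theorem adj_val_compl (δ : Dart m d) (a : ZMod 2) : (graph R c).Adj (.inl (δ, a)) (.inl (δ, a + 1)) :=
  adj_of_hrel (by simp [(zmod2_add_one_ne a).symm]) (by simp [hrel])

/-- The link between a dart and its reverse: `(δ, a) — (rot δ, a + 1)` (the straight CFI connection, forcing equal values on the two darts of an edge). [cite: CaiFurerImmerman1992, §6] -/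
theorem adj_val_link (δ : Dart m d) (a : ZMod 2) :
    (graph R c).Adj (.inl (δ, a)) (.inl (R.rot δ, a + 1)) :=
  adj_of_hrel (by simp [(zmod2_add_one_ne a).symm]) (by simp [hrel])

/-- A half-edge (fixed dart) has its value forced to `0`: `(δ, 1)` is joined to the colour `0` ("true"). [folklore] -/
theorem adj_val_true_of_fixed {δ : Dart m d} (h : R.rot δ = δ) :
    (graph R c).Adj (.inl (δ, 1)) (.inr (.inr 0)) :=
  adj_of_hrel (by simp) (by simp [hrel, h])

variable {w : Fin m} {ρ : Fin d → ZMod 2}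

/-- The internal triangle `u — u' — o — u` of an OR-position of an active clause gadget (the textbook OR-gadget of the 3-SAT → 3-colouring reduction; cf. Papadimitriou 1994, §9.3, where the reduction starts from NAESAT). [folklore] -/
theorem adj_gad_gad (hact : Active c w ρ) {i : Fin d} (hi : 1 ≤ i.val) {j j' : Fin 3}
    (hjj' : (j = 0 ∧ j' = 1) ∨ (j = 0 ∧ j' = 2) ∨ (j = 1 ∧ j' = 2)) :
    (graph R c).Adj (.inr (.inl (w, ρ, i, j))) (.inr (.inl (w, ρ, i, j'))) := by
  refine adj_of_hrel ?_ ?_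
  · have : j ≠ j' := by
      rcases hjj' with ⟨rfl, rfl⟩ | ⟨rfl, rfl⟩ | ⟨rfl, rfl⟩ <;> decide
    simpa using this
  · simp [hrel, hact, hi, hjj']

/-- Chaining of OR-positions: the output `o_i` feeds the left input node `u_{i+1}`. [folklore] -/
theorem adj_gad_succ (hact : Active c w ρ) {i i' : Fin d} (hi : 1 ≤ i.val) (hii' : i'.val = i.val + 1) :
    (graph R c).Adj (.inr (.inl (w, ρ, i, 2))) (.inr (.inl (w, ρ, i', 0))) := by
  refine adj_of_hrel (by simp) ?_
  simp [hrel, hact, hi, hii']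

/-- The left input node of the first OR-position reads the literal `0` of the clause. [folklore] -/
theorem adj_gad_lit_zero (hact : Active c w ρ) {i : Fin d} (hi : i.val = 1) :
    (graph R c).Adj (.inr (.inl (w, ρ, i, 0))) (.inl (lit w ρ ⟨0, i.pos⟩)) := by
  refine adj_of_hrel (by simp) ?_
  simp [hrel, hact, hi]

/-- The right input node of OR-position `i` reads the literal `i` of the clause. [folklore] -/
theorem adj_gad_lit (hact : Active c w ρ) {i : Fin d} (hi : 1 ≤ i.val) :
    (graph R c).Adj (.inr (.inl (w, ρ, i, 1))) (.inl (lit w ρ i)) := by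
  refine adj_of_hrel (by simp) ?_
  simp [hrel, hact, hi]

/-- Outputs of OR-positions are joined to the base colour (they carry truth values). [folklore] -/
theorem adj_gad_base (hact : Active c w ρ) {i : Fin d} (hi : 1 ≤ i.val) :
    (graph R c).Adj (.inr (.inl (w, ρ, i, 2))) (.inr (.inr 2)) := by
  refine adj_of_hrel (by simp) ?_
  simp [hrel, hact, hi]

/-- The last output of an active clause gadget is joined to the colour `1` ("false"): the clause must hold. [folklore] -/
theorem adj_gad_false (hact : Active c w ρ) {i : Fin d} (hi : 1 ≤ i.val) (hlast : i.val + 1 = d) :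
    (graph R c).Adj (.inr (.inl (w, ρ, i, 2))) (.inr (.inr 1)) := by
  refine adj_of_hrel (by simp) ?_
  simp [hrel, hact, hi, hlast]

end adj

/-! ### Odd total charge: `H(R, c)` is not 3-colourable -/

section unsat

variable {R} {c : Fin m → ZMod 2} (κ : (graph R c).Coloring (Fin 3))

/-- The assignment read off a 3-colouring: `x δ = 1` iff the value vertex `(δ, 1)` has the colour of
the palette vertex `0` ("true"). [folklore] -/
noncomputable def assignment (δ : Dart m d) : ZMod 2 := if κ (.inl (δ, 1)) = κ (.inr (.inr 0)) then 1 else 0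

/-- The colours of the palette vertices `0` and `1` differ. [folklore] -/
theorem T_ne_F : κ (.inr (.inr 0)) ≠ κ (.inr (.inr 1)) := κ.valid (adj_pal (by decide))
/-- The colours of the palette vertices `0` and `2` differ. [folklore] -/
theorem T_ne_B : κ (.inr (.inr 0)) ≠ κ (.inr (.inr 2)) := κ.valid (adj_pal (by decide))
/-- The colours of the palette vertices `1` and `2` differ. [folklore] -/
theorem F_ne_B : κ (.inr (.inr 1)) ≠ κ (.inr (.inr 2)) := κ.valid (adj_pal (by decide))

/-- A value vertex carries a truth value (colour of palette vertex `0` or `1`). [folklore] -/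
theorem val_cases (δ : Dart m d) (a : ZMod 2) : κ (.inl (δ, a)) = κ (.inr (.inr 0)) ∨ κ (.inl (δ, a)) = κ (.inr (.inr 1)) := by
  rcases fin3_cases (T_ne_F κ) (T_ne_B κ) (F_ne_B κ) (κ (.inl (δ, a))) with h | h | h
  · exact Or.inl h
  · exact Or.inr h
  · exact absurd h (κ.valid (adj_val_base δ a))

/-- A value vertex `(δ, a)` is "true" iff `x δ = a`. [folklore] -/
theorem val_true_iff (δ : Dart m d) (a : ZMod 2) : κ (.inl (δ, a)) = κ (.inr (.inr 0)) ↔ assignment κ δ = a := by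
  have h01 : κ (.inl (δ, 0)) ≠ κ (.inl (δ, 1)) := by
    have := κ.valid (adj_val_compl (c := c) δ 0)
    simpa using this
  rcases zmod2_eq_zero_or_one a with rfl | rfl
  · unfold assignment
    constructor
    · intro h0
      rw [if_neg]
      intro h1; exact h01 (h0.trans h1.symm)
    · intro h
      have h1 : κ (.inl (δ, 1)) ≠ κ (.inr (.inr 0)) := by
        intro h1; rw [if_pos h1] at h; exact absurd h (by decide)
      rcases val_cases κ δ 1 with h1' | h1'
      · exact absurd h1' h1
      rcases val_cases κ δ 0 with h0 | h0
      · exact h0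
      · exact absurd (h0.trans h1'.symm) h01
  · unfold assignment
    by_cases h : κ (.inl (δ, 1)) = κ (.inr (.inr 0)) <;> simp [h]

/-- The two darts of an edge carry the same value (the links). [folklore] -/
theorem assignment_rot (δ : Dart m d) : assignment κ (R.rot δ) = assignment κ δ := by
  have hT : κ (.inl (δ, assignment κ δ)) = κ (.inr (.inr 0)) := (val_true_iff κ δ _).2 rfl
  have hne : κ (.inl (R.rot δ, assignment κ δ + 1)) ≠ κ (.inr (.inr 0)) := by
    rw [← hT]; exact (κ.valid (adj_val_link δ _)).symm
  rw [Ne, val_true_iff] at hne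
  exact zmod2_eq_of_ne_add_one hne

/-- Half-edges carry the value `0`. [folklore] -/
theorem assignment_fixed {δ : Dart m d} (h : R.rot δ = δ) : assignment κ δ = 0 := by
  have hne : κ (.inl (δ, 1)) ≠ κ (.inr (.inr 0)) := κ.valid (adj_val_true_of_fixed h)
  unfold assignment; rw [if_neg hne]

/-- In an active clause gadget some literal vertex is "true" (the OR-chain). [folklore] -/
theorem exists_lit_true (hd : 2 ≤ d) {w : Fin m} {ρ : Fin d → ZMod 2} (hact : Active c w ρ) :
    ∃ i, κ (.inl (lit w ρ i)) = κ (.inr (.inr 0)) := by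
  by_contra hall
  push Not at hall
  have hF : ∀ i, κ (.inl (lit w ρ i)) = κ (.inr (.inr 1)) := fun i => by
    rcases val_cases κ (w, i) (ρ i + 1) with h | h
    · exact absurd h (hall i)
    · exact h
  -- the outputs of the OR-chain are all "false"
  have chain : ∀ n (h1 : 1 ≤ n) (hn : n < d), κ (.inr (.inl (w, ρ, ⟨n, hn⟩, 2))) = κ (.inr (.inr 1)) := by
    intro n h1
    induction n, h1 using Nat.le_induction with
    | base =>
      intro hn
      refine fin3_or_gadget (T_ne_F κ) (T_ne_B κ) (F_ne_B κ)
        (u := κ (.inr (.inl (w, ρ, ⟨1, hn⟩, 0)))) (u' := κ (.inr (.inl (w, ρ, ⟨1, hn⟩, 1)))) ?_ ?_ ?_ ?_ ?_ ?_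
      · rw [← hF ⟨0, by omega⟩]; exact κ.valid (adj_gad_lit_zero hact rfl)
      · rw [← hF ⟨1, hn⟩]; exact κ.valid (adj_gad_lit hact le_rfl)
      · exact κ.valid (adj_gad_gad hact le_rfl (Or.inl ⟨rfl, rfl⟩))
      · exact (κ.valid (adj_gad_gad hact le_rfl (Or.inr (Or.inl ⟨rfl, rfl⟩)))).symm
      · exact (κ.valid (adj_gad_gad hact le_rfl (Or.inr (Or.inr ⟨rfl, rfl⟩)))).symm
      · exact κ.valid (adj_gad_base hact le_rfl)
    | succ n h1 ih =>
      intro hn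
      have hn' : n < d := by omega
      refine fin3_or_gadget (T_ne_F κ) (T_ne_B κ) (F_ne_B κ)
        (u := κ (.inr (.inl (w, ρ, ⟨n + 1, hn⟩, 0)))) (u' := κ (.inr (.inl (w, ρ, ⟨n + 1, hn⟩, 1))))
        ?_ ?_ ?_ ?_ ?_ ?_
      · rw [← ih hn']
        exact (κ.valid (adj_gad_succ (i := ⟨n, hn'⟩) (i' := ⟨n + 1, hn⟩) hact h1 rfl)).symm
      · rw [← hF ⟨n + 1, hn⟩]; exact κ.valid (adj_gad_lit hact (by simp))
      · exact κ.valid (adj_gad_gad hact (by simp) (Or.inl ⟨rfl, rfl⟩))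
      · exact (κ.valid (adj_gad_gad hact (by simp) (Or.inr (Or.inl ⟨rfl, rfl⟩)))).symm
      · exact (κ.valid (adj_gad_gad hact (by simp) (Or.inr (Or.inr ⟨rfl, rfl⟩)))).symm
      · exact κ.valid (adj_gad_base hact (by simp))
  have hlast := chain (d - 1) (by omega) (by omega)
  exact κ.valid (adj_gad_false hact (i := ⟨d - 1, by omega⟩) (by simp; omega) (by simp; omega)) hlast

/-- Every parity constraint is satisfied by the assignment read off a 3-colouring. [folklore] -/
theorem sum_assignment_eq (hd : 2 ≤ d) (w : Fin m) : (∑ i, assignment κ (w, i)) = c w := by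
  by_contra hne
  obtain ⟨i, hi⟩ := exists_lit_true κ hd (ρ := fun i => assignment κ (w, i)) hne
  rw [lit, val_true_iff] at hi
  exact zmod2_add_one_ne _ hi.symm

/-- **Odd total charge forbids a 3-colouring.** [folklore] -/
theorem not_colorable_of_sum_ne_zero (hd : 2 ≤ d) (hc : (∑ w, c w) ≠ 0) : ¬ (graph R c).Colorable 3 := by
  rintro ⟨κ⟩
  apply hc
  calc (∑ w, c w) = ∑ w, ∑ i, assignment κ (w, i) := by simp_rw [sum_assignment_eq κ hd]
    _ = ∑ δ : Dart m d, assignment κ δ := (Fintype.sum_prod_type _).symm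
    _ = 0 := by
      refine Finset.sum_involution (fun δ _ => R.rot δ) (fun δ _ => ?_) (fun δ _ hδ => ?_)
        (fun δ _ => Finset.mem_univ _) (fun δ _ => R.rot_rot δ)
      · rw [assignment_rot, zmod2_add_self]
      · intro h; exact hδ (assignment_fixed κ h)

end unsat

/-! ### Zero charges: an explicit 3-colouring of `H(R, 0)` -/

section sat

/-- "Some earlier literal of the clause is true": `∃ i' < i, ρ i' = 1`. [folklore] -/
def Earlier (ρ : Fin d → ZMod 2) (i : Fin d) : Prop := ∃ i' : Fin d, i'.val < i.val ∧ ρ i' = 1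

/-- `Earlier ρ i` is decidable. [folklore] -/
instance (ρ : Fin d → ZMod 2) (i : Fin d) : Decidable (Earlier ρ i) := by unfold Earlier; infer_instance

/-- `Earlier` at the next position: an earlier true literal, or the current one. [folklore] -/
theorem earlier_succ_iff (ρ : Fin d → ZMod 2) {i i' : Fin d} (h : i'.val = i.val + 1) :
    Earlier ρ i' ↔ Earlier ρ i ∨ ρ i = 1 := by
  constructor
  · rintro ⟨k, hk, hρk⟩
    by_cases hki : k.val < i.val
    · exact Or.inl ⟨k, hki, hρk⟩
    · have : k = i := Fin.ext (by omega)
      exact Or.inr (this ▸ hρk)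
  · rintro (⟨k, hk, hρk⟩ | h1)
    · exact ⟨k, by omega, hρk⟩
    · exact ⟨i, by omega, h1⟩

/-- `Earlier` at position `1` reads the literal `0`. [folklore] -/
theorem earlier_one_iff (ρ : Fin d → ZMod 2) {i : Fin d} (h : i.val = 1) :
    Earlier ρ i ↔ ρ ⟨0, i.pos⟩ = 1 := by
  constructor
  · rintro ⟨k, hk, hρk⟩
    have : k = ⟨0, i.pos⟩ := Fin.ext (by show k.val = 0; omega)
    exact this ▸ hρk
  · intro h0; exact ⟨⟨0, i.pos⟩, by show 0 < i.val; omega, h0⟩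

/-- An active clause for zero charges has a true literal at or before the last position. [folklore] -/
theorem earlier_or_of_active_last {ρ : Fin d → ZMod 2} {w : Fin m} (hact : Active 0 w ρ) {i : Fin d}
    (hlast : i.val + 1 = d) : Earlier ρ i ∨ ρ i = 1 := by
  unfold Active at hact
  simp only [Pi.zero_apply] at hact
  obtain ⟨k, -, hk⟩ : ∃ k ∈ (Finset.univ : Finset (Fin d)), ρ k ≠ 0 := by
    by_contra h; push Not at h; exact hact (Finset.sum_eq_zero h)
  rw [zmod2_ne_zero_iff] at hk
  by_cases hki : k.val < i.val
  · exact Or.inl ⟨k, hki, hk⟩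
  · have : k = i := Fin.ext (by omega)
    exact Or.inr (this ▸ hk)

/-- The explicit colouring (palette `t ↦ t`; value `(δ, a)` true iff `a = 0`, i.e. the zero
assignment; gadgets coloured along the OR-chain). [folklore] -/
def colour0 : Vert m d → Fin 3
  | .inl (_, a) => if a = 0 then 0 else 1
  | .inr (.inr t) => t
  | .inr (.inl (_, ρ, i, j)) =>
      if j = 2 then (if Earlier ρ i ∨ ρ i = 1 then 0 else 1)
      else if j = 0 then (if ρ i = 1 then 2 else if Earlier ρ i then 1 else 0)
      else (if ρ i = 1 then 1 else 2)

/-- The colour of a literal vertex under `colour0`. [folklore] -/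
theorem colour0_lit (w : Fin m) (ρ : Fin d → ZMod 2) (i : Fin d) :
    colour0 (m := m) (.inl (lit w ρ i)) = if ρ i = 1 then 0 else 1 := by
  simp only [colour0, lit, zmod2_add_one_eq_zero_iff]

variable {R}

/-- `colour0` separates every generating pair of `H(R, 0)`. [folklore] -/
theorem colour0_ne_of_hrel {x y : Vert m d} (h : hrel R 0 x y) : colour0 x ≠ colour0 y := by
  rcases x with ⟨δ, a⟩ | ⟨w, ρ, i, j⟩ | t <;> rcases y with ⟨δ', a'⟩ | ⟨w', ρ', i', j'⟩ | t' <;>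
    simp only [hrel] at h
  · obtain ⟨-, rfl⟩ := h
    have h11 : (1 : ZMod 2) + 1 = 0 := by decide
    rcases zmod2_eq_zero_or_one a with rfl | rfl <;> simp [colour0, h11]
  · rcases h with rfl | ⟨rfl, rfl, -⟩
    · rcases zmod2_eq_zero_or_one a with rfl | rfl <;> simp [colour0]
    · simp [colour0]
  · -- gadget / value
    obtain ⟨-, hi, hcase⟩ := h
    simp only [lit, Prod.mk.injEq] at hcase
    rcases hcase with ⟨rfl, hi1, rfl, rfl⟩ | ⟨rfl, rfl, rfl⟩
    · have hE := earlier_one_iff ρ hi1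
      simp only [colour0, Fin.isValue, zmod2_add_one_eq_zero_iff]
      by_cases hL : ρ i = 1 <;> by_cases h0 : ρ ⟨0, i.pos⟩ = 1 <;> simp [hL, h0, hE]
    · simp only [colour0, Fin.isValue, zmod2_add_one_eq_zero_iff]
      by_cases hL : ρ i = 1 <;> simp [hL]
  · -- gadget / gadget
    obtain ⟨hw, hρ, -, hi, hcase⟩ := h
    subst w'
    subst ρ'
    rcases hcase with ⟨hii, hjj'⟩ | ⟨hii', rfl, rfl⟩
    · subst i'
      rcases hjj' with ⟨rfl, rfl⟩ | ⟨rfl, rfl⟩ | ⟨rfl, rfl⟩ <;>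
        simp only [colour0, Fin.isValue] <;>
        by_cases hE : Earlier ρ i <;> by_cases hL : ρ i = 1 <;> simp [*]
    · have hE' := earlier_succ_iff ρ hii'
      simp only [colour0, Fin.isValue]
      by_cases hE : Earlier ρ i <;> by_cases hL : ρ i = 1 <;> by_cases hL' : ρ i' = 1 <;>
        simp [hE, hL, hL', hE']
  · -- gadget / palette
    obtain ⟨hact, hi, rfl, ht⟩ := h
    rcases ht with rfl | ⟨rfl, hlast⟩
    · simp only [colour0, Fin.isValue]
      by_cases hE : Earlier ρ i ∨ ρ i = 1 <;> simp [hE]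
    · have hE := earlier_or_of_active_last hact hlast
      simp [colour0, hE]
  · simpa [colour0] using h

/-- **`H(R, 0)` is 3-colourable.** [folklore] -/
theorem colorable_zero : (graph R 0).Colorable 3 :=
  ⟨SimpleGraph.Coloring.mk colour0 fun {x y} hxy => by
    rw [graph, SimpleGraph.fromRel_adj] at hxy
    rcases hxy.2 with h | h
    · exact colour0_ne_of_hrel h
    · exact (colour0_ne_of_hrel h).symm⟩

end sat

end Literature.ModelTheory.FiniteModelTheory.TseitinColouring

/-! ## Territory graphs, components, expansion, local consistency -/

namespace Literature.ModelTheory.FiniteModelTheory.TseitinColouring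

open Finset
open Literature.Computability.Complexity.Expander (RotGraph)

variable {m d : ℕ} (R : RotGraph m d)

/-- A generic induction principle along reachability. [folklore] -/
theorem reachable_induct {V : Type*} {G : SimpleGraph V} {u : V} (P : V → Prop) (h0 : P u)
    (hstep : ∀ z z', P z → G.Adj z z' → P z') {w : V} (h : G.Reachable u w) : P w := by
  rw [SimpleGraph.reachable_iff_reflTransGen] at h
  induction h with
  | refl => exact h0
  | tail _ hzz' ih => exact hstep _ _ ih hzz'

/-- The generating relation of the territory graph: an unblocked dart (with unblocked reverse)
from `u` to `w`. [folklore] -/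
def terrRel (D : Finset (Dart m d)) (u w : Fin m) : Prop :=
  ∃ i, R.nbr u i = w ∧ (u, i) ∉ D ∧ R.rot (u, i) ∉ D

/-- The generating relation of the territory graph is symmetric (reverse the dart). [folklore] -/
theorem terrRel_symm {D : Finset (Dart m d)} {u w : Fin m} (h : terrRel R D u w) : terrRel R D w u := by
  obtain ⟨i, hw, h1, h2⟩ := h
  subst hw
  refine ⟨R.rlab u i, R.nbr_rlab u i, h2, ?_⟩
  show R.rot (R.rot (u, i)) ∉ D
  rw [R.rot_rot]; exact h1

/-- **The territory graph** of the blocked dart set `D`: `u ~ w` iff `u ≠ w` and some dart from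
`u` to `w` is unblocked together with its reverse. [folklore] -/
def terr (D : Finset (Dart m d)) : SimpleGraph (Fin m) := SimpleGraph.fromRel (terrRel R D)

/-- Adjacency in the territory graph. [folklore] -/
theorem terr_adj_iff {D : Finset (Dart m d)} {u w : Fin m} :
    (terr R D).Adj u w ↔ u ≠ w ∧ ∃ i, R.nbr u i = w ∧ (u, i) ∉ D ∧ R.rot (u, i) ∉ D := by
  rw [terr, SimpleGraph.fromRel_adj]
  refine ⟨fun ⟨hne, h⟩ => ⟨hne, ?_⟩, fun ⟨hne, h⟩ => ⟨hne, Or.inl h⟩⟩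
  rcases h with h | h
  · exact h
  · exact terrRel_symm R h

/-- Blocking fewer darts gives a bigger territory graph. [folklore] -/
theorem terr_mono {D D' : Finset (Dart m d)} (h : D' ⊆ D) : terr R D ≤ terr R D' := by
  intro u w huw
  rw [terr_adj_iff] at huw ⊢
  obtain ⟨hne, i, hw, h1, h2⟩ := huw
  exact ⟨hne, i, hw, fun h1' => h1 (h h1'), fun h2' => h2 (h h2')⟩

open Classical in
/-- The component (reachability set) of `u` in the territory graph of `D`. [folklore] -/
noncomputable def comp (D : Finset (Dart m d)) (u : Fin m) : Finset (Fin m) :=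
  Finset.univ.filter fun w => (terr R D).Reachable u w

/-- Membership in a component is reachability. [folklore] -/
theorem mem_comp {D : Finset (Dart m d)} {u w : Fin m} : w ∈ comp R D u ↔ (terr R D).Reachable u w := by
  classical
  simp [comp]

/-- A vertex lies in its own component. [folklore] -/
theorem mem_comp_self (D : Finset (Dart m d)) (u : Fin m) : u ∈ comp R D u :=
  (mem_comp R).2 SimpleGraph.Reachable.rfl

/-- Reachable vertices have the same component. [folklore] -/
theorem comp_eq_of_reachable {D : Finset (Dart m d)} {u u' : Fin m} (h : (terr R D).Reachable u u') :
    comp R D u = comp R D u' := by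
  ext w
  rw [mem_comp, mem_comp]
  exact ⟨fun hw => h.symm.trans hw, fun hw => h.trans hw⟩

/-- Components are equal iff one base point lies in the other component. [folklore] -/
theorem comp_eq_iff {D : Finset (Dart m d)} {u w : Fin m} : comp R D w = comp R D u ↔ w ∈ comp R D u := by
  constructor
  · intro h
    have := mem_comp_self R D w
    rw [h] at this
    exact this
  · intro h
    exact (comp_eq_of_reachable R ((mem_comp R).1 h)).symm

/-- Blocking fewer darts enlarges components. [folklore] -/
theorem comp_subset_of_subset {D D' : Finset (Dart m d)} (h : D' ⊆ D) (u : Fin m) :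
    comp R D u ⊆ comp R D' u := by
  intro w hw
  rw [mem_comp] at hw ⊢
  exact hw.mono (terr_mono R h)

/-- Components of mutually unreachable vertices are disjoint. [folklore] -/
theorem disjoint_comp {D : Finset (Dart m d)} {u u' : Fin m} (h : ¬ (terr R D).Reachable u u') :
    Disjoint (comp R D u) (comp R D u') := by
  rw [Finset.disjoint_left]
  intro w hw hw'
  rw [mem_comp] at hw hw'
  exact h (hw.trans hw'.symm)

/-- Components are non-empty. [folklore] -/
theorem card_comp_pos (D : Finset (Dart m d)) (u : Fin m) : 0 < (comp R D u).card :=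
  Finset.card_pos.2 ⟨u, mem_comp_self R D u⟩

/-- Two components with more than `m/2` vertices each coincide. [folklore] -/
theorem reachable_of_big {D : Finset (Dart m d)} {u u' : Fin m} (hu : m < 2 * (comp R D u).card)
    (hu' : m < 2 * (comp R D u').card) : (terr R D).Reachable u u' := by
  by_contra h
  have hdis := disjoint_comp R h
  have hle : (comp R D u ∪ comp R D u').card ≤ m := by
    simpa using Finset.card_le_univ (comp R D u ∪ comp R D u')
  rw [Finset.card_union_of_disjoint hdis] at hle
  omega

/-! ### Blocked dart sets and admissible partial assignments -/

/-- Admissible pairs `(D, v)`: `D` is closed under reversing darts; `v` is constant on edges,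
vanishes off `D` and on half-edges. [folklore] -/
structure DAdm (D : Finset (Dart m d)) (v : Dart m d → ZMod 2) : Prop where
  rot_mem : ∀ δ ∈ D, R.rot δ ∈ D
  rot_eq : ∀ δ, v (R.rot δ) = v δ
  zero_off : ∀ δ, δ ∉ D → v δ = 0
  fixed : ∀ δ, R.rot δ = δ → v δ = 0

/-- An admissible pair gives an admissible dart function. [folklore] -/
theorem DAdm.adm {D : Finset (Dart m d)} {v : Dart m d → ZMod 2} (h : DAdm R D v) : Adm R v :=
  ⟨h.rot_eq, h.fixed⟩

/-- A rot-closed dart set contains a dart iff it contains its reverse. [folklore] -/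
theorem rot_mem_iff_of_closed {D : Finset (Dart m d)} (hD : ∀ δ ∈ D, R.rot δ ∈ D) (δ : Dart m d) :
    R.rot δ ∈ D ↔ δ ∈ D := by
  refine ⟨fun h' => ?_, hD δ⟩
  have := hD _ h'
  rwa [R.rot_rot] at this

/-- A dart leaving a component of the territory graph is blocked. [folklore] -/
theorem mem_of_leaving {D : Finset (Dart m d)} (hD : ∀ δ ∈ D, R.rot δ ∈ D) {u : Fin m}
    {x : Dart m d} (hx : x.1 ∈ comp R D u) (hx' : R.nbr x.1 x.2 ∉ comp R D u) : x ∈ D := by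
  by_contra h
  have hrot : R.rot x ∉ D := fun h' => h ((rot_mem_iff_of_closed R hD x).1 h')
  apply hx'
  rw [mem_comp] at hx ⊢
  by_cases heq : x.1 = R.nbr x.1 x.2
  · rw [← heq]; exact hx
  · exact hx.trans (SimpleGraph.Adj.reachable ((terr_adj_iff R).2 ⟨heq, x.2, rfl, h, hrot⟩))

/-- **Edge expansion** of the rotation map: `η |Q| ≤ #{darts leaving Q}` for `2|Q| ≤ m`
(the shape of `Expander.Family.edgeExpansion_X`). [folklore] -/
structure EdgeExpansion (η : ℝ) : Prop where
  pos : 0 < η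
  expand : ∀ Q : Finset (Fin m), 2 * Q.card ≤ m →
    η * Q.card ≤ ((Finset.univ.filter fun x : Fin m × Fin d => x.1 ∈ Q ∧ R.nbr x.1 x.2 ∉ Q).card : ℝ)

/-- The darts leaving a component are blocked darts issuing from it. [folklore] -/
theorem leaving_card_le {D : Finset (Dart m d)} (hD : ∀ δ ∈ D, R.rot δ ∈ D) (u : Fin m) :
    (Finset.univ.filter fun x : Fin m × Fin d => x.1 ∈ comp R D u ∧ R.nbr x.1 x.2 ∉ comp R D u).card ≤
      (D.filter fun x => x.1 ∈ comp R D u).card := by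
  refine Finset.card_le_card fun x hx => ?_
  rw [Finset.mem_filter] at hx ⊢
  exact ⟨mem_of_leaving R hD hx.2.1 hx.2.2, hx.2.1⟩

/-- With no blocked darts every component has more than `m/2` vertices (the territory graph of an
edge expander is connected). [folklore] -/
theorem big_of_empty {η : ℝ} (hR : EdgeExpansion R η) (u : Fin m) : m < 2 * (comp R ∅ u).card := by
  by_contra h
  push Not at h
  have h1 := hR.expand _ h
  have h2 := leaving_card_le R (D := ∅) (by simp) u
  simp only [Finset.filter_empty, Finset.card_empty, Nat.le_zero, Finset.card_eq_zero] at h2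
  rw [h2, Finset.card_empty, Nat.cast_zero] at h1
  have hpos := card_comp_pos R (∅ : Finset (Dart m d)) u
  have : (0 : ℝ) < η * (comp R ∅ u).card := mul_pos hR.pos (by exact_mod_cast hpos)
  linarith

/-- **A big component exists** as long as fewer than `η m` darts are blocked. [folklore] -/
theorem exists_big {η : ℝ} (hR : EdgeExpansion R η) {D : Finset (Dart m d)} (hD : ∀ δ ∈ D, R.rot δ ∈ D)
    (hcard : (D.card : ℝ) < η * m) : ∃ u, m < 2 * (comp R D u).card := by
  by_contra h
  push Not at h
  set t : Finset (Finset (Fin m)) := Finset.univ.image (comp R D) with ht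
  have hmaps : ∀ w ∈ (Finset.univ : Finset (Fin m)), comp R D w ∈ t := fun w _ =>
    Finset.mem_image_of_mem _ (Finset.mem_univ w)
  have hfib : ∀ Q ∈ t, (Finset.univ.filter fun w => comp R D w = Q) = Q := by
    intro Q hQ
    obtain ⟨u, -, rfl⟩ := Finset.mem_image.1 hQ
    ext w
    simp only [Finset.mem_filter, Finset.mem_univ, true_and]
    exact comp_eq_iff R
  -- `m = ∑_{Q ∈ t} |Q|`
  have hm : (m : ℝ) = ∑ Q ∈ t, (Q.card : ℝ) := by
    have h1 := Finset.card_eq_sum_card_fiberwise hmaps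
    rw [Finset.card_univ, Fintype.card_fin] at h1
    have h2 : (m : ℝ) = ((∑ Q ∈ t, (Finset.univ.filter fun w => comp R D w = Q).card : ℕ) : ℝ) := by
      exact_mod_cast h1
    rw [h2, Nat.cast_sum]
    refine Finset.sum_congr rfl fun Q hQ => ?_
    rw [hfib Q hQ]
  -- `|D| = ∑_{Q ∈ t} |D ∩ darts from Q|`
  have hDsum : (D.card : ℝ) = ∑ Q ∈ t, ((D.filter fun x => x.1 ∈ Q).card : ℝ) := by
    have := Finset.card_eq_sum_card_fiberwise (f := fun x : Dart m d => comp R D x.1) (s := D) (t := t)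
      fun x _ => hmaps x.1 (Finset.mem_univ _)
    rw [this, Nat.cast_sum]
    refine Finset.sum_congr rfl fun Q hQ => ?_
    obtain ⟨u, -, rfl⟩ := Finset.mem_image.1 hQ
    congr 2
    ext x
    simp only [Finset.mem_filter, and_congr_right_iff]
    intro _
    exact comp_eq_iff R
  have key : ∀ Q ∈ t, η * (Q.card : ℝ) ≤ ((D.filter fun x => x.1 ∈ Q).card : ℝ) := by
    intro Q hQ
    obtain ⟨u, -, rfl⟩ := Finset.mem_image.1 hQ
    refine (hR.expand _ (h u)).trans ?_
    exact_mod_cast leaving_card_le R hD u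
  have : η * (m : ℝ) ≤ D.card := by
    rw [hm, hDsum, Finset.mul_sum]
    exact Finset.sum_le_sum key
  linarith

/-! ### Local consistency -/

/-- **Local consistency** of `(D, v)` for the charges `c`: every territory component with at most
`m/2` vertices has even total charge `∑ (c w + ∂v w)`. [folklore] -/
structure LocCons (c : Fin m → ZMod 2) (D : Finset (Dart m d)) (v : Dart m d → ZMod 2) : Prop where
  even : ∀ u, 2 * (comp R D u).card ≤ m → ∑ w ∈ comp R D u, (c w + bd v w) = 0

/-- No darts blocked: the zero assignment is locally consistent (all components are big). [folklore] -/
theorem locCons_empty {η : ℝ} (hR : EdgeExpansion R η) (c : Fin m → ZMod 2) :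
    LocCons R c ∅ (fun _ => 0) :=
  ⟨fun u hu => absurd (big_of_empty R hR u) (not_lt.2 hu)⟩

/-- The empty pair is admissible. [folklore] -/
theorem dAdm_empty : DAdm R (∅ : Finset (Dart m d)) (fun _ => 0) :=
  ⟨by simp, fun _ => rfl, fun _ _ => rfl, fun _ _ => rfl⟩

/-- A vertex all of whose darts are blocked is a singleton component; if `m ≥ 2` local consistency
makes its own constraint hold: `c w + ∂v w = 0`. [folklore] -/
theorem constraint_of_blocked {c : Fin m → ZMod 2} {D : Finset (Dart m d)} {v : Dart m d → ZMod 2}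
    (hL : LocCons R c D v) (hm : 2 ≤ m) {w : Fin m} (hw : ∀ i, (w, i) ∈ D) : c w + bd v w = 0 := by
  have hcomp : comp R D w = {w} := by
    ext z
    rw [mem_comp, Finset.mem_singleton]
    constructor
    · intro hz
      refine reachable_induct (G := terr R D) (fun z => z = w) rfl ?_ hz
      rintro z z' rfl hzz'
      obtain ⟨-, i, -, hi, -⟩ := (terr_adj_iff R).1 hzz'
      exact absurd (hw i) hi
    · rintro rfl; rfl
  have := hL.even w (by rw [hcomp, Finset.card_singleton]; omega)
  rwa [hcomp, Finset.sum_singleton] at this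

/-! ### Restriction -/

/-- Restriction of a dart function to `D'` (zero outside). [folklore] -/
noncomputable def restrictTo (D' : Finset (Dart m d)) (v : Dart m d → ZMod 2) : Dart m d → ZMod 2 :=
  fun δ => if δ ∈ D' then v δ else 0

/-- Restriction to a rot-closed subset preserves admissibility. [folklore] -/
theorem dAdm_restrict {D D' : Finset (Dart m d)} {v : Dart m d → ZMod 2} (hD : DAdm R D v)
    (hrot : ∀ δ ∈ D', R.rot δ ∈ D') : DAdm R D' (restrictTo D' v) := by
  have hiff := rot_mem_iff_of_closed R hrot
  refine ⟨hrot, fun δ => ?_, fun δ hδ => ?_, fun δ hδ => ?_⟩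
  · simp only [restrictTo, hiff, hD.rot_eq]
  · simp [restrictTo, hδ]
  · simp [restrictTo, hD.fixed δ hδ]

/-- A sum of boundaries over a vertex set is a sum over the darts issuing from it. [folklore] -/
theorem bd_sum_eq (v : Dart m d → ZMod 2) (S : Finset (Fin m)) :
    ∑ w ∈ S, bd v w = ∑ x ∈ S ×ˢ (Finset.univ : Finset (Fin d)), v x := by
  rw [Finset.sum_product]
  rfl

/-- **Restriction preserves local consistency.** [folklore] -/
theorem locCons_restrict {c : Fin m → ZMod 2} {D D' : Finset (Dart m d)} {v : Dart m d → ZMod 2}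
    (hD : DAdm R D v) (hL : LocCons R c D v) (hsub : D' ⊆ D) (hrot : ∀ δ ∈ D', R.rot δ ∈ D') :
    LocCons R c D' (restrictTo D' v) := by
  refine ⟨fun u hsmall => ?_⟩
  set C' := comp R D' u with hC'
  -- the difference `g = v - v'` sums to zero over the darts from `C'`
  set g : Dart m d → ZMod 2 := fun δ => if δ ∈ D' then 0 else v δ with hg
  have hvg : ∀ δ, v δ = restrictTo D' v δ + g δ := fun δ => by
    by_cases h : δ ∈ D' <;> simp [restrictTo, hg, h]
  have hgsum : ∑ w ∈ C', bd g w = 0 := by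
    rw [bd_sum_eq]
    set s' := (C' ×ˢ (Finset.univ : Finset (Fin d))).filter fun x => x ∉ D' with hs'
    have h1 : ∑ x ∈ C' ×ˢ (Finset.univ : Finset (Fin d)), g x = ∑ x ∈ s', v x := by
      rw [hs', Finset.sum_filter]
      refine Finset.sum_congr rfl fun x _ => ?_
      by_cases h : x ∈ D' <;> simp [hg, h]
    rw [h1]
    have hiff := rot_mem_iff_of_closed R hrot
    have hmem : ∀ x ∈ s', R.rot x ∈ s' := by
      intro x hx
      simp only [hs', Finset.mem_filter, Finset.mem_product, Finset.mem_univ, and_true] at hx ⊢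
      refine ⟨?_, by rw [hiff]; exact hx.2⟩
      have hx1 : x.1 ∈ C' := hx.1
      rw [hC', mem_comp] at hx1 ⊢
      by_cases heq : x.1 = R.nbr x.1 x.2
      · rw [R.rot_apply, ← heq]; exact hx1
      · rw [R.rot_apply]
        exact hx1.trans (SimpleGraph.Adj.reachable
          ((terr_adj_iff R).2 ⟨heq, x.2, rfl, hx.2, by rw [hiff]; exact hx.2⟩))
    refine Finset.sum_involution (fun x _ => R.rot x) (fun x _ => ?_) (fun x _ hx => ?_) hmem
      (fun x _ => R.rot_rot x)
    · rw [hD.rot_eq, zmod2_add_self]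
    · intro h; exact hx (hD.fixed x h)
  -- the sum of `c + ∂v` over `C'` splits along the `D`-components, each small and even
  have hvsum : ∑ w ∈ C', (c w + bd v w) = 0 := by
    have hmaps : ∀ w ∈ C', comp R D w ∈ C'.image (comp R D) := fun w hw => Finset.mem_image_of_mem _ hw
    rw [← Finset.sum_fiberwise_of_maps_to hmaps]
    refine Finset.sum_eq_zero fun Q hQ => ?_
    obtain ⟨w₀, hw₀, rfl⟩ := Finset.mem_image.1 hQ
    have hsubC : comp R D w₀ ⊆ C' := by
      have h1 := comp_subset_of_subset R hsub w₀
      have h2 : comp R D' w₀ = C' := comp_eq_of_reachable R ((mem_comp R).1 hw₀).symm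
      rw [← h2]; exact h1
    have hfib : (C'.filter fun w => comp R D w = comp R D w₀) = comp R D w₀ := by
      ext w
      simp only [Finset.mem_filter]
      rw [comp_eq_iff R]
      exact ⟨fun h => h.2, fun h => ⟨hsubC h, h⟩⟩
    rw [hfib]
    exact hL.even w₀ ((Nat.mul_le_mul_left 2 (Finset.card_le_card hsubC)).trans hsmall)
  have hbd : ∀ w, bd v w = bd (restrictTo D' v) w + bd g w := fun w => by
    simp only [bd, ← Finset.sum_add_distrib]
    exact Finset.sum_congr rfl fun i _ => hvg (w, i)
  calc ∑ w ∈ C', (c w + bd (restrictTo D' v) w)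
      = ∑ w ∈ C', ((c w + bd v w) + bd g w) := by
        refine Finset.sum_congr rfl fun w _ => ?_
        rw [hbd w]
        simp only [add_assoc, zmod2_add_self, add_zero]
    _ = 0 := by rw [Finset.sum_add_distrib, hvsum, hgsum, add_zero]


/-! ### One-edge extension -/

/-- Equal territory graphs have equal components. [folklore] -/
theorem comp_congr {D D' : Finset (Dart m d)} (h : terr R D = terr R D') (u : Fin m) :
    comp R D u = comp R D' u := by
  unfold comp; rw [h]

/-- Blocking a self-loop or a half-edge does not change the territory graph. [folklore] -/
theorem terr_insert_loop {D : Finset (Dart m d)} {δ₀ : Dart m d} (hloop : (R.rot δ₀).1 = δ₀.1) :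
    terr R (insert δ₀ (insert (R.rot δ₀) D)) = terr R D := by
  ext a b'
  constructor
  · exact fun h => terr_mono R (by intro x hx; simp [hx]) h
  · intro h
    rw [terr_adj_iff] at h ⊢
    obtain ⟨hab, i, hb, h1, h2⟩ := h
    have hne1 : (a, i) ≠ δ₀ := by
      rintro heq
      apply hab
      rw [← hb, RotGraph.nbr, heq, hloop, ← heq]
    have hne2 : (a, i) ≠ R.rot δ₀ := by
      rintro heq
      apply hab
      have ha : a = δ₀.1 := by rw [← hloop, ← heq]
      rw [← hb, RotGraph.nbr, heq, R.rot_rot, ha]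
    have hne3 : R.rot (a, i) ≠ δ₀ := by
      intro heq; apply hne2; rw [← heq, R.rot_rot]
    have hne4 : R.rot (a, i) ≠ R.rot δ₀ := by
      intro heq; apply hne1
      have := congrArg R.rot heq
      rwa [R.rot_rot, R.rot_rot] at this
    refine ⟨hab, i, hb, ?_, ?_⟩
    · simp [hne1, hne2, h1]
    · simp [hne3, hne4, h2]

/-- Extension of `v` by the value `b` on the edge `{δ₀, rot δ₀}`. [folklore] -/
noncomputable def extendBy (v : Dart m d → ZMod 2) (δ₀ : Dart m d) (b : ZMod 2) : Dart m d → ZMod 2 :=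
  fun δ => v δ + if δ = δ₀ ∨ δ = R.rot δ₀ then b else 0

/-- Extending by the value `0` changes nothing. [folklore] -/
theorem extendBy_zero (v : Dart m d → ZMod 2) (δ₀ : Dart m d) : extendBy R v δ₀ 0 = v := by
  funext δ; simp [extendBy]

/-- The extension agrees with `v` on the old darts. [folklore] -/
theorem extendBy_of_mem {D : Finset (Dart m d)} {v : Dart m d → ZMod 2} {δ₀ : Dart m d} (hδ₀ : δ₀ ∉ D)
    (hrot : R.rot δ₀ ∉ D) (b : ZMod 2) {δ : Dart m d} (hδ : δ ∈ D) : extendBy R v δ₀ b δ = v δ := by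
  have h1 : δ ≠ δ₀ := fun h => hδ₀ (h ▸ hδ)
  have h2 : δ ≠ R.rot δ₀ := fun h => hrot (h ▸ hδ)
  simp [extendBy, h1, h2]

/-- The one-edge extension is admissible (value `0` on a half-edge). [folklore] -/
theorem dAdm_extend {D : Finset (Dart m d)} {v : Dart m d → ZMod 2} (hD : DAdm R D v) (δ₀ : Dart m d)
    {b : ZMod 2} (hb : R.rot δ₀ = δ₀ → b = 0) :
    DAdm R (insert δ₀ (insert (R.rot δ₀) D)) (extendBy R v δ₀ b) := by
  refine ⟨fun δ hδ => ?_, fun δ => ?_, fun δ hδ => ?_, fun δ hδ => ?_⟩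
  · simp only [Finset.mem_insert] at hδ ⊢
    rcases hδ with rfl | rfl | hδ
    · exact Or.inr (Or.inl rfl)
    · exact Or.inl (R.rot_rot _)
    · exact Or.inr (Or.inr (hD.rot_mem δ hδ))
  · have h1 : R.rot δ = δ₀ ↔ δ = R.rot δ₀ := by
      constructor
      · intro h; rw [← h, R.rot_rot]
      · intro h; rw [h, R.rot_rot]
    have h2 : R.rot δ = R.rot δ₀ ↔ δ = δ₀ := by
      constructor
      · intro h; have := congrArg R.rot h; rwa [R.rot_rot, R.rot_rot] at this
      · intro h; rw [h]
    simp only [extendBy, hD.rot_eq, h1, h2, or_comm]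
  · simp only [Finset.mem_insert, not_or] at hδ
    simp [extendBy, hδ.1, hδ.2.1, hD.zero_off δ hδ.2.2]
  · simp only [extendBy, hD.fixed δ hδ, zero_add]
    split_ifs with h
    · rcases h with rfl | rfl
      · exact hb hδ
      · rw [R.rot_rot] at hδ
        exact hb hδ.symm
    · rfl

/-- Summing the indicator of a two-element set. [folklore] -/
private theorem sum_ite_or_eq {α : Type*} [DecidableEq α] (s : Finset α) {a a' : α} (h : a ≠ a') (b : ZMod 2) :
    ∑ x ∈ s, (if x = a ∨ x = a' then b else 0) = (if a ∈ s then b else 0) + (if a' ∈ s then b else 0) := by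
  have : ∀ x, (if x = a ∨ x = a' then b else 0) = (if x = a then b else 0) + (if x = a' then b else 0) := by
    intro x
    by_cases hx : x = a
    · subst hx; simp [h]
    · simp [hx]
  simp_rw [this]
  rw [Finset.sum_add_distrib, Finset.sum_ite_eq', Finset.sum_ite_eq']

/-- Charge sums of the extension: the old sums plus `b` for each of the two endpoints in the set. [folklore] -/
theorem sum_extendBy (c : Fin m → ZMod 2) (v : Dart m d → ZMod 2) {δ₀ : Dart m d} (hne : R.rot δ₀ ≠ δ₀)
    (b : ZMod 2) (K : Finset (Fin m)) :
    ∑ w ∈ K, (c w + bd (extendBy R v δ₀ b) w) =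
      ∑ w ∈ K, (c w + bd v w) + ((if δ₀.1 ∈ K then b else 0) + (if (R.rot δ₀).1 ∈ K then b else 0)) := by
  classical
  have hbd : ∀ w, bd (extendBy R v δ₀ b) w = bd v w + ∑ i, (if (w, i) = δ₀ ∨ (w, i) = R.rot δ₀ then b else 0) := by
    intro w
    simp only [bd, extendBy, Finset.sum_add_distrib]
  have hbd' : ∀ w, c w + bd (extendBy R v δ₀ b) w =
      (c w + bd v w) + ∑ i, (if (w, i) = δ₀ ∨ (w, i) = R.rot δ₀ then b else 0) := by
    intro w; rw [hbd, add_assoc]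
  have hprod : ∑ w ∈ K, ∑ i, (if (w, i) = δ₀ ∨ (w, i) = R.rot δ₀ then b else 0) =
      ∑ x ∈ K ×ˢ (Finset.univ : Finset (Fin d)), (if x = δ₀ ∨ x = R.rot δ₀ then b else 0) := by
    rw [Finset.sum_product]
  rw [Finset.sum_congr rfl (fun w _ => hbd' w), Finset.sum_add_distrib, hprod,
    sum_ite_or_eq _ (Ne.symm hne) b]
  simp [Finset.mem_product]

/-- **One-edge extension of a locally consistent partial assignment.** If `(D, v)` is admissible
and locally consistent, `δ₀ ∉ D`, and after blocking the edge of `δ₀` fewer than `η m` darts are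
blocked, then some value `b` on that edge keeps local consistency. [folklore] -/
theorem locCons_extend {η : ℝ} (hR : EdgeExpansion R η) {c : Fin m → ZMod 2} {D : Finset (Dart m d)}
    {v : Dart m d → ZMod 2} (hD : DAdm R D v) (hL : LocCons R c D v) {δ₀ : Dart m d} (hδ₀ : δ₀ ∉ D)
    (hcard : ((insert δ₀ (insert (R.rot δ₀) D)).card : ℝ) < η * m) :
    ∃ b : ZMod 2, (R.rot δ₀ = δ₀ → b = 0) ∧
      LocCons R c (insert δ₀ (insert (R.rot δ₀) D)) (extendBy R v δ₀ b) := by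
  set D' := insert δ₀ (insert (R.rot δ₀) D) with hD'
  have hsubD : D ⊆ D' := by intro x hx; simp [hD', hx]
  by_cases hloop : (R.rot δ₀).1 = δ₀.1
  · refine ⟨0, fun _ => rfl, ?_⟩
    rw [extendBy_zero]
    have hT : terr R D' = terr R D := terr_insert_loop R hloop
    refine ⟨fun u hu => ?_⟩
    rw [comp_congr R hT] at hu ⊢
    exact hL.even u hu
  -- the main case: a genuine edge `y1 — y2`
  have hrot0 : R.rot δ₀ ∉ D := fun h => hδ₀ ((rot_mem_iff_of_closed R hD.rot_mem δ₀).1 h)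
  have hδne : R.rot δ₀ ≠ δ₀ := fun h => hloop (by rw [h])
  set y1 := δ₀.1 with hy1
  set y2 := (R.rot δ₀).1 with hy2
  have hadj : (terr R D).Adj y1 y2 :=
    (terr_adj_iff R).2 ⟨Ne.symm hloop, δ₀.2, rfl, hδ₀, hrot0⟩
  have hD'rot : ∀ δ ∈ D', R.rot δ ∈ D' := (dAdm_extend R hD δ₀ (b := 0) (fun _ => rfl)).rot_mem
  -- (i) adjacency in `terr D` is adjacency in `terr D'` or the edge `y1 y2`
  have hadj_cases : ∀ a b', (terr R D).Adj a b' →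
      (terr R D').Adj a b' ∨ (a = y1 ∧ b' = y2) ∨ (a = y2 ∧ b' = y1) := by
    intro a b' h
    obtain ⟨hab, i, hb, h1, h2⟩ := (terr_adj_iff R).1 h
    by_cases hx1 : (a, i) = δ₀
    · refine Or.inr (Or.inl ⟨congrArg Prod.fst hx1, ?_⟩)
      rw [← hb, RotGraph.nbr, hx1]
    by_cases hx2 : (a, i) = R.rot δ₀
    · refine Or.inr (Or.inr ⟨congrArg Prod.fst hx2, ?_⟩)
      rw [← hb, RotGraph.nbr, hx2, R.rot_rot]
    have hx3 : R.rot (a, i) ≠ δ₀ := fun heq => hx2 (by rw [← heq, R.rot_rot])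
    have hx4 : R.rot (a, i) ≠ R.rot δ₀ := fun heq => hx1 (by
      have := congrArg R.rot heq; rwa [R.rot_rot, R.rot_rot] at this)
    refine Or.inl ((terr_adj_iff R).2 ⟨hab, i, hb, ?_, ?_⟩)
    · simp [hD', hx1, hx2, h1]
    · simp [hD', hx3, hx4, h2]
  -- (ii) away from `y1`, `y2` reachability is preserved
  have hpres : ∀ x, ¬ (terr R D').Reachable x y1 → ¬ (terr R D').Reachable x y2 →
      ∀ z, (terr R D).Reachable x z → (terr R D').Reachable x z := by
    intro x hx1 hx2 z hz
    refine reachable_induct (G := terr R D) (fun z => (terr R D').Reachable x z)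
      SimpleGraph.Reachable.rfl ?_ hz
    intro z z' hPz hzz'
    rcases hadj_cases z z' hzz' with h | ⟨rfl, rfl⟩ | ⟨rfl, rfl⟩
    · exact hPz.trans h.reachable
    · exact absurd hPz hx1
    · exact absurd hPz hx2
  -- (iii) the old component of `y1` splits into the new components of `y1` and `y2`
  have hsplit : ∀ z, (terr R D).Reachable y1 z →
      (terr R D').Reachable y1 z ∨ (terr R D').Reachable y2 z := by
    intro z hz
    refine reachable_induct (G := terr R D)
      (fun z => (terr R D').Reachable y1 z ∨ (terr R D').Reachable y2 z) (Or.inl SimpleGraph.Reachable.rfl)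
      ?_ hz
    intro z z' hPz hzz'
    rcases hadj_cases z z' hzz' with h | ⟨-, rfl⟩ | ⟨-, rfl⟩
    · rcases hPz with h' | h'
      · exact Or.inl (h'.trans h.reachable)
      · exact Or.inr (h'.trans h.reachable)
    · exact Or.inr SimpleGraph.Reachable.rfl
    · exact Or.inl SimpleGraph.Reachable.rfl
  set C1 := comp R D' y1 with hC1
  set C2 := comp R D' y2 with hC2
  set B0 := comp R D y1 with hB0
  have hC1sub : C1 ⊆ B0 := comp_subset_of_subset R hsubD y1
  have hC2sub : C2 ⊆ B0 := by
    rw [hB0, comp_eq_of_reachable R hadj.reachable]; exact comp_subset_of_subset R hsubD y2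
  have hunion : B0 = C1 ∪ C2 := by
    ext z
    rw [Finset.mem_union]
    constructor
    · intro hz
      rcases hsplit z ((mem_comp R).1 hz) with h | h
      · exact Or.inl ((mem_comp R).2 h)
      · exact Or.inr ((mem_comp R).2 h)
    · rintro (hz | hz)
      · exact hC1sub hz
      · exact hC2sub hz
  set F : Fin m → ZMod 2 := fun w => c w + bd v w with hF
  set b : ZMod 2 := if 2 * C1.card ≤ m then ∑ w ∈ C1, F w else ∑ w ∈ C2, F w with hb
  refine ⟨b, fun h => absurd h hδne, ⟨fun u hsmall => ?_⟩⟩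
  set K := comp R D' u with hK
  rw [sum_extendBy R c v hδne b K]
  change ∑ w ∈ K, F w + _ = 0
  -- components coincide with `K` as soon as they meet it
  have hKeq : ∀ {y}, y ∈ K → comp R D' y = K := fun hy =>
    (comp_eq_of_reachable R ((mem_comp R).1 hy)).symm
  by_cases h1 : y1 ∈ K <;> by_cases h2 : y2 ∈ K
  · -- both endpoints in `K`: `K = C1 = B0`
    have hK1 : C1 = K := hKeq h1
    have h12 : (terr R D').Reachable y1 y2 := by
      have h2' := h2
      rw [← hK1] at h2'
      exact (mem_comp R).1 h2'
    have hB0K : B0 = K := by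
      refine Finset.Subset.antisymm ?_ (hK1 ▸ hC1sub)
      intro z hz
      rw [← hK1, hC1, mem_comp]
      rcases hsplit z ((mem_comp R).1 hz) with h | h
      · exact h
      · exact h12.trans h
    have h0 : ∑ w ∈ K, F w = 0 := by
      rw [← hB0K]; exact hL.even y1 (by show 2 * B0.card ≤ m; rw [hB0K]; exact hsmall)
    rw [h0, if_pos h1, if_pos h2, zmod2_add_self, add_zero]
  · -- only `y1`: `K = C1`, small, and `b = ∑_{C1} F`
    have hK1 : C1 = K := hKeq h1
    have hsm1 : 2 * C1.card ≤ m := by rw [hK1]; exact hsmall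
    have hbv : b = ∑ w ∈ K, F w := by rw [hb, if_pos hsm1, hK1]
    rw [if_pos h1, if_neg h2, add_zero, hbv, zmod2_add_self]
  · -- only `y2`: `K = C2`
    have hK2 : C2 = K := hKeq h2
    have h21 : ¬ (terr R D').Reachable y1 y2 := by
      intro h; apply h1; rw [← hK2, hC2, mem_comp]; exact h.symm
    rw [if_neg h1, if_pos h2, zero_add]
    by_cases hsm1 : 2 * C1.card ≤ m
    · have hbv : b = ∑ w ∈ C1, F w := by rw [hb, if_pos hsm1]
      rw [hbv, ← hK2]
      -- `∑_{C2} F + ∑_{C1} F = ∑_{B0} F`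
      have hdis : Disjoint C1 C2 := disjoint_comp R h21
      have hB0sum : ∑ w ∈ B0, F w = ∑ w ∈ C1, F w + ∑ w ∈ C2, F w := by
        rw [hunion, Finset.sum_union hdis]
      by_cases hB : 2 * B0.card ≤ m
      · rw [add_comm, ← hB0sum]
        exact hL.even y1 hB
      · -- `B0` big but both halves small: impossible by expansion
        exfalso
        have hsm2 : 2 * C2.card ≤ m := by rw [hK2]; exact hsmall
        obtain ⟨x₀, hx₀⟩ := exists_big R hR hD'rot hcard
        by_cases hx1 : y1 ∈ comp R D' x₀
        · have hc1 : comp R D' x₀ = C1 := comp_eq_of_reachable R ((mem_comp R).1 hx1)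
          rw [hc1] at hx₀
          omega
        · by_cases hx2 : y2 ∈ comp R D' x₀
          · have hc2 : comp R D' x₀ = C2 := comp_eq_of_reachable R ((mem_comp R).1 hx2)
            rw [hc2] at hx₀
            omega
          · have hy1 : ¬ (terr R D').Reachable x₀ y1 := fun h => hx1 ((mem_comp R).2 h)
            have hy2 : ¬ (terr R D').Reachable x₀ y2 := fun h => hx2 ((mem_comp R).2 h)
            have hsub : comp R D x₀ ⊆ comp R D' x₀ := fun z hz =>
              (mem_comp R).2 (hpres x₀ hy1 hy2 z ((mem_comp R).1 hz))
            have hbig : m < 2 * (comp R D x₀).card :=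
              lt_of_lt_of_le hx₀ (Nat.mul_le_mul_left 2
                (Finset.card_le_card (comp_subset_of_subset R hsubD x₀)))
            have hB0big : m < 2 * B0.card := lt_of_not_ge hB
            have hreach : (terr R D).Reachable x₀ y1 := (reachable_of_big R hB0big hbig).symm
            exact hx1 (hsub ((mem_comp R).2 hreach))
    · have hbv : b = ∑ w ∈ K, F w := by rw [hb, if_neg hsm1, hK2]
      rw [hbv, zmod2_add_self]
  · -- neither: `K` is an old component
    have hy1 : ¬ (terr R D').Reachable u y1 := fun h => h1 ((mem_comp R).2 h)
    have hy2 : ¬ (terr R D').Reachable u y2 := fun h => h2 ((mem_comp R).2 h)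
    have hKold : comp R D u = K := by
      refine Finset.Subset.antisymm (fun z hz => (mem_comp R).2 (hpres u hy1 hy2 z ((mem_comp R).1 hz)))
        (comp_subset_of_subset R hsubD u)
    rw [if_neg h1, if_neg h2, add_zero, add_zero, ← hKold]
    exact hL.even u (by rw [hKold]; exact hsmall)

end Literature.ModelTheory.FiniteModelTheory.TseitinColouring

/-! ## Duplicator's winning strategy -/

namespace Literature.ModelTheory.FiniteModelTheory.TseitinColouring

open Finset
open Literature.Computability.Complexity.Expander (RotGraph)

variable {m d : ℕ} (R : RotGraph m d)

/-- The darts a pebbled vertex needs assigned: the edge of a value vertex, all edges at the vertex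
of a gadget vertex, nothing for a palette vertex. [folklore] -/
def need : Vert m d → Finset (Dart m d)
  | .inl (δ, _) => {δ, R.rot δ}
  | .inr (.inl (w, _, _, _)) =>
      (Finset.univ.image fun i : Fin d => ((w, i) : Dart m d)) ∪ (Finset.univ.image fun i : Fin d => R.rot (w, i))
  | .inr (.inr _) => ∅

/-- The needed darts of a vertex are closed under reversal. [folklore] -/
theorem rot_mem_need {x : Vert m d} {δ : Dart m d} (h : δ ∈ need R x) : R.rot δ ∈ need R x := by
  rcases x with ⟨δ', a⟩ | ⟨w, ρ, i, j⟩ | t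
  · simp only [need, Finset.mem_insert, Finset.mem_singleton] at h ⊢
    rcases h with rfl | rfl
    · exact Or.inr rfl
    · exact Or.inl (R.rot_rot _)
  · simp only [need, Finset.mem_union, Finset.mem_image, Finset.mem_univ, true_and] at h ⊢
    rcases h with ⟨i, rfl⟩ | ⟨i, rfl⟩
    · exact Or.inr ⟨i, rfl⟩
    · exact Or.inl ⟨i, (R.rot_rot _).symm⟩
  · simp [need] at h

/-- A vertex needs at most `2d` darts. [folklore] -/
theorem card_need_le (hd : 1 ≤ d) (x : Vert m d) : (need R x).card ≤ 2 * d := by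
  rcases x with ⟨δ, a⟩ | ⟨w, ρ, i, j⟩ | t
  · simp only [need]
    exact (Finset.card_insert_le _ _).trans (by simp; omega)
  · simp only [need]
    refine (Finset.card_union_le _ _).trans ?_
    have h1 := Finset.card_image_le (s := (Finset.univ : Finset (Fin d))) (f := fun i : Fin d => ((w, i) : Dart m d))
    have h2 := Finset.card_image_le (s := (Finset.univ : Finset (Fin d))) (f := fun i : Fin d => R.rot (w, i))
    simp only [Finset.card_univ, Fintype.card_fin] at h1 h2
    omega
  · simp [need]

/-- A gadget vertex at `w` needs every dart at `w`. [folklore] -/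
theorem mem_need_gadget (w : Fin m) (ρ : Fin d → ZMod 2) (i i' : Fin d) (j : Fin 3) :
    ((w, i') : Dart m d) ∈ need R (.inr (.inl (w, ρ, i, j))) := by
  simp [need]

/-- A value vertex needs its own dart. [folklore] -/
theorem mem_need_val (δ : Dart m d) (a : ZMod 2) : δ ∈ need R (.inl (δ, a)) := by
  simp [need]

/-- Two dart functions agreeing on `need x` shift `x` identically. [folklore] -/
theorem shift_congr {v v' : Dart m d → ZMod 2} {x : Vert m d} (h : ∀ δ ∈ need R x, v δ = v' δ) :
    shift v x = shift v' x := by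
  rcases x with ⟨δ, a⟩ | ⟨w, ρ, i, j⟩ | t
  · simp only [shift, h δ (mem_need_val R δ a)]
  · simp only [shift, Sum.inr.injEq, Sum.inl.injEq, Prod.mk.injEq, true_and, and_true]
    funext i'
    simp only [Pi.add_apply, h (w, i') (mem_need_gadget R w ρ i i' j)]
  · rfl

open Classical in
/-- The darts needed by a position `p`. [folklore] -/
noncomputable def Need (p : Set (Vert m d × Vert m d)) : Finset (Dart m d) :=
  Finset.univ.filter fun δ => ∃ x ∈ p, δ ∈ need R x.1

/-- Membership in the needed darts of a position. [folklore] -/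
theorem mem_Need {p : Set (Vert m d × Vert m d)} {δ : Dart m d} :
    δ ∈ Need R p ↔ ∃ x ∈ p, δ ∈ need R x.1 := by
  classical
  simp [Need]

/-- The needed darts are monotone in the position. [folklore] -/
theorem Need_mono {p q : Set (Vert m d × Vert m d)} (h : q ⊆ p) : Need R q ⊆ Need R p := by
  intro δ hδ
  rw [mem_Need] at hδ ⊢
  obtain ⟨x, hx, hδ⟩ := hδ
  exact ⟨x, h hx, hδ⟩

/-- The needed darts of a position are closed under reversal. [folklore] -/
theorem rot_mem_Need {p : Set (Vert m d × Vert m d)} {δ : Dart m d} (h : δ ∈ Need R p) :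
    R.rot δ ∈ Need R p := by
  rw [mem_Need] at h ⊢
  obtain ⟨x, hx, hδ⟩ := h
  exact ⟨x, hx, rot_mem_need R hδ⟩

/-- A pebbled vertex has its needed darts among those of the position. [folklore] -/
theorem need_subset_Need {p : Set (Vert m d × Vert m d)} {x : Vert m d × Vert m d} (hx : x ∈ p) :
    need R x.1 ⊆ Need R p := fun _ hδ => (mem_Need R).2 ⟨x, hx, hδ⟩

/-- The empty position needs no darts. [folklore] -/
theorem Need_empty : Need R (∅ : Set (Vert m d × Vert m d)) = ∅ := by
  ext δ; simp [mem_Need]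

/-- The needed darts after one more pebble pair. [folklore] -/
theorem Need_insert (p : Set (Vert m d × Vert m d)) (z : Vert m d × Vert m d) :
    Need R (insert z p) = need R z.1 ∪ Need R p := by
  ext δ
  simp only [mem_Need, Set.mem_insert_iff, Finset.mem_union]
  constructor
  · rintro ⟨x, rfl | hx, hδ⟩
    · exact Or.inl hδ
    · exact Or.inr ⟨x, hx, hδ⟩
  · rintro (hδ | ⟨x, hx, hδ⟩)
    · exact ⟨z, Or.inl rfl, hδ⟩
    · exact ⟨x, Or.inr hx, hδ⟩

/-- A position with `|p|` pairs needs at most `2d |p|` darts. [folklore] -/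
theorem card_Need_le {p : Set (Vert m d × Vert m d)} (hp : p.Finite) (hd : 1 ≤ d) :
    (Need R p).card ≤ 2 * d * p.ncard := by
  classical
  have heq : Need R p = hp.toFinset.biUnion fun x => need R x.1 := by
    ext δ
    simp [mem_Need]
  rw [heq, Set.ncard_eq_toFinset_card p hp]
  refine (Finset.card_biUnion_le).trans ?_
  calc ∑ x ∈ hp.toFinset, (need R x.1).card ≤ ∑ x ∈ hp.toFinset, 2 * d :=
        Finset.sum_le_sum fun x _ => card_need_le R hd x.1
    _ = 2 * d * hp.toFinset.card := by rw [Finset.sum_const, smul_eq_mul]; ring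

/-! ### Iterated extension -/

/-- **Extension to a rot-closed set of darts**, keeping admissibility and local consistency, as
long as fewer than `η m` darts get blocked. [folklore] -/
theorem extend_many {η : ℝ} (hR : EdgeExpansion R η) {c : Fin m → ZMod 2} (S : Finset (Dart m d))
    (hS : ∀ δ ∈ S, R.rot δ ∈ S) :
    ∀ (n : ℕ) (D : Finset (Dart m d)) (v : Dart m d → ZMod 2), (S \ D).card ≤ n → DAdm R D v →
      LocCons R c D v → (((D ∪ S).card : ℝ) < η * m) →
      ∃ v', DAdm R (D ∪ S) v' ∧ LocCons R c (D ∪ S) v' ∧ ∀ δ ∈ D, v' δ = v δ := by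
  intro n
  induction n with
  | zero =>
    intro D v hn hD hL _
    have hSD : S ⊆ D := by
      intro δ hδ; by_contra h
      have : δ ∈ S \ D := Finset.mem_sdiff.2 ⟨hδ, h⟩
      rw [Nat.le_zero, Finset.card_eq_zero] at hn
      rw [hn] at this; simp at this
    rw [Finset.union_eq_left.2 hSD]
    exact ⟨v, hD, hL, fun _ _ => rfl⟩
  | succ n ih =>
    intro D v hn hD hL hcard
    by_cases hSD : S ⊆ D
    · rw [Finset.union_eq_left.2 hSD]
      exact ⟨v, hD, hL, fun _ _ => rfl⟩
    obtain ⟨δ₀, hδ₀S, hδ₀D⟩ : ∃ δ₀ ∈ S, δ₀ ∉ D := by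
      by_contra h; push Not at h; exact hSD h
    set D₁ := insert δ₀ (insert (R.rot δ₀) D) with hD₁
    have hD₁sub : D₁ ⊆ D ∪ S := by
      intro x hx
      simp only [hD₁, Finset.mem_insert] at hx
      rcases hx with rfl | rfl | hx
      · exact Finset.mem_union_right _ hδ₀S
      · exact Finset.mem_union_right _ (hS _ hδ₀S)
      · exact Finset.mem_union_left _ hx
    have hcard₁ : (D₁.card : ℝ) < η * m :=
      lt_of_le_of_lt (by exact_mod_cast Finset.card_le_card hD₁sub) hcard
    obtain ⟨b, hb, hL₁⟩ := locCons_extend R hR hD hL hδ₀D hcard₁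
    have hD₁adm := dAdm_extend R hD δ₀ hb
    have hrot0 : R.rot δ₀ ∉ D := fun h => hδ₀D ((rot_mem_iff_of_closed R hD.rot_mem δ₀).1 h)
    have hn₁ : (S \ D₁).card ≤ n := by
      have hss : S \ D₁ ⊆ (S \ D).erase δ₀ := by
        intro x hx
        simp only [Finset.mem_sdiff, hD₁, Finset.mem_insert, not_or] at hx
        exact Finset.mem_erase.2 ⟨hx.2.1, Finset.mem_sdiff.2 ⟨hx.1, hx.2.2.2⟩⟩
      have := Finset.card_le_card hss
      rw [Finset.card_erase_of_mem (Finset.mem_sdiff.2 ⟨hδ₀S, hδ₀D⟩)] at this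
      omega
    have hunion : D₁ ∪ S = D ∪ S := by
      refine Finset.Subset.antisymm (Finset.union_subset hD₁sub Finset.subset_union_right) ?_
      refine Finset.union_subset ?_ Finset.subset_union_right
      intro x hx
      exact Finset.mem_union_left _ (by simp [hD₁, hx])
    obtain ⟨v', hv'adm, hv'L, hv'eq⟩ := ih D₁ _ hn₁ hD₁adm hL₁ (by rw [hunion]; exact hcard)
    rw [hunion] at hv'adm hv'L
    refine ⟨v', hv'adm, hv'L, fun δ hδ => ?_⟩
    rw [hv'eq δ (by simp [hD₁, hδ]), extendBy_of_mem R hδ₀D hrot0 b hδ]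

/-! ### The strategy -/

section strategy

variable {R}
variable {η : ℝ} (hR : EdgeExpansion R η) (c : Fin m → ZMod 2) (hm : 2 ≤ m) (hd : 1 ≤ d) {K : ℕ}
  (hK : (2 * d * K : ℝ) < η * m)

/-- Winning positions: at most `K` pebble pairs lying on the graph of the shift by an admissible,
locally consistent partial assignment of the needed darts. [folklore] -/
structure Good (p : Set (Vert m d × Vert m d)) (v : Dart m d → ZMod 2) : Prop where
  adm : DAdm R (Need R p) v
  cons : LocCons R c (Need R p) v
  graph : ∀ x ∈ p, x.2 = shift v x.1

/-- `g + g = 0` for `ZMod 2`-valued functions. [folklore] -/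
private theorem pi_add_self (g : Fin d → ZMod 2) : g + g = 0 := funext fun i => zmod2_add_self (g i)

include hm in
/-- In a winning position the constraint of every pebbled gadget's vertex holds for the shifted charges, so the shifted charges agree with `0` there (Atserias–Dawar 2019, proof of Lemma 3.2: "`v_r + v_s + v_t = b_i`"). [cite: AtseriasDawar2019, Lemma 3.2 (proof)] -/
theorem agrees_of_good {p : Set (Vert m d × Vert m d)} {v : Dart m d → ZMod 2} (hg : Good (R := R) c p v)
    {x : Vert m d × Vert m d} (hx : x ∈ p) : Agrees (c + bd v) 0 (shift v x.1) := by
  obtain ⟨x1, x2⟩ := x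
  rcases x1 with ⟨δ, a⟩ | ⟨w, ρ, i, j⟩ | t
  · trivial
  · show (c + bd v) w = (0 : Fin m → ZMod 2) w
    rw [Pi.add_apply, Pi.zero_apply]
    exact constraint_of_blocked R hg.cons hm fun i' =>
      need_subset_Need R hx (mem_need_gadget R w ρ i i' j)
  · trivial

include hm in
/-- **Winning positions are partial isomorphisms** `H(R, c) ⇀ H(R, 0)` (Atserias–Dawar 2019, proof of Lemma 3.2: "the map from `x_1^{a_1}, …` to `x_1^{a_1+v_1}, …` is a partial isomorphism"). [cite: AtseriasDawar2019, Lemma 3.2 (proof)] -/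
theorem isPartialIso_of_good {p : Set (Vert m d × Vert m d)} {v : Dart m d → ZMod 2}
    (hg : Good (R := R) c p v) : IsPartialIso (graph R c) (graph R 0) p := by
  refine ⟨fun x hx y hy => ?_, fun x hx y hy => ?_⟩
  · rw [hg.graph x hx, hg.graph y hy]
    exact ((shift_involutive v).injective.eq_iff).symm
  · rw [hg.graph x hx, hg.graph y hy]
    rw [← graph_adj_congr R (agrees_of_good c hm hg hx) (agrees_of_good c hm hg hy)]
    exact (graph_adj_shift_iff R hg.adm.adm c x.1 y.1).symm

/-- Lifting pebbles keeps a position winning (restrict the partial assignment). [folklore] -/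
theorem good_mono {p q : Set (Vert m d × Vert m d)} {v : Dart m d → ZMod 2} (hg : Good (R := R) c p v)
    (hqp : q ⊆ p) : Good (R := R) c q (restrictTo (Need R q) v) := by
  refine ⟨dAdm_restrict R hg.adm (fun δ hδ => rot_mem_Need R hδ),
    locCons_restrict R hg.adm hg.cons (Need_mono R hqp) (fun δ hδ => rot_mem_Need R hδ), fun x hx => ?_⟩
  rw [hg.graph x (hqp hx)]
  refine shift_congr R fun δ hδ => ?_
  have : δ ∈ Need R q := need_subset_Need R hx hδ
  simp [restrictTo, this]

include hR hd hK in
/-- Budget: a position with fewer than `K` pairs plus one more vertex needs fewer than `η m` darts when `2dK < η m`. [folklore] -/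
theorem card_lt_of_ncard_lt {p : Set (Vert m d × Vert m d)} (hp : p.Finite) (hpK : p.ncard < K)
    (z : Vert m d) : ((Need R p ∪ need R z).card : ℝ) < η * m := by
  have h1 : (Need R p ∪ need R z).card ≤ 2 * d * K := by
    refine (Finset.card_union_le _ _).trans ?_
    have := card_Need_le R hp hd (p := p)
    have := card_need_le R hd z
    calc (Need R p).card + (need R z).card ≤ 2 * d * p.ncard + 2 * d := by omega
      _ = 2 * d * (p.ncard + 1) := by ring
      _ ≤ 2 * d * K := Nat.mul_le_mul_left _ hpK
  have _ := hR
  calc ((Need R p ∪ need R z).card : ℝ) ≤ ((2 * d * K : ℕ) : ℝ) := by exact_mod_cast h1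
    _ = 2 * d * K := by push_cast; ring
    _ < η * m := hK

include hR hm hd hK in
/-- **Duplicator wins the bijective `K`-pebble game on `H(R, c)` and `H(R, 0)`** whenever
`2 d K < η m` (`R` an `η`-edge-expander on `m ≥ 2` vertices, `d ≥ 1`). [folklore] -/
theorem ckEquiv_graph : CkEquiv K (graph R c) (graph R 0) := by
  classical
  refine ⟨{ carrier := {p | p.Finite ∧ p.ncard ≤ K ∧ ∃ v, Good (R := R) c p v}
            empty_mem := ?_
            finite_of_mem := fun p hp => hp.1
            ncard_le_of_mem := fun p hp => hp.2.1
            isPartialIso_of_mem := fun p hp => ?_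
            mem_of_subset := fun p hp q hqp => ?_
            forth := fun p hp hpK => ?_ }⟩
  · refine ⟨Set.finite_empty, by simp, fun _ => 0, ?_, ?_, fun x hx => (Set.notMem_empty x hx).elim⟩
    · rw [Need_empty]; exact dAdm_empty R
    · rw [Need_empty]; exact locCons_empty R hR c
  · obtain ⟨v, hg⟩ := hp.2.2
    exact isPartialIso_of_good c hm hg
  · obtain ⟨v, hg⟩ := hp.2.2
    exact ⟨hp.1.subset hqp, (Set.ncard_le_ncard hqp hp.1).trans hp.2.1, _, good_mono c hg hqp⟩
  · obtain ⟨hpfin, -, v, hg⟩ := hp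
    -- the chosen extensions, one for each set of extra darts
    have hex : ∀ z : Vert m d, ∃ v', DAdm R (Need R p ∪ need R z) v' ∧
        LocCons R c (Need R p ∪ need R z) v' ∧ ∀ δ ∈ Need R p, v' δ = v δ := fun z =>
      extend_many R hR (need R z) (fun δ hδ => rot_mem_need R hδ) _ (Need R p) v le_rfl hg.adm hg.cons
        (card_lt_of_ncard_lt hR hd hK hpfin hpK z)
    -- Duplicator's bijection: shift each vertex by the extension chosen for its own needs
    have hexS : ∀ S : Finset (Dart m d), (∃ z : Vert m d, need R z = S) →
        ∃ v', DAdm R (Need R p ∪ S) v' ∧ LocCons R c (Need R p ∪ S) v' ∧ ∀ δ ∈ Need R p, v' δ = v δ := by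
      rintro S ⟨z, rfl⟩; exact hex z
    set E : Finset (Dart m d) → Dart m d → ZMod 2 := fun S =>
      if h : ∃ z : Vert m d, need R z = S then Classical.choose (hexS S h) else v with hE
    have hEspec : ∀ z : Vert m d, DAdm R (Need R p ∪ need R z) (E (need R z)) ∧
        LocCons R c (Need R p ∪ need R z) (E (need R z)) ∧ ∀ δ ∈ Need R p, E (need R z) δ = v δ := by
      intro z
      have h : ∃ z' : Vert m d, need R z' = need R z := ⟨z, rfl⟩
      have hEz : E (need R z) = Classical.choose (hexS _ h) := by
        simp only [hE, dif_pos h]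
      rw [hEz]
      exact Classical.choose_spec (hexS _ h)
    set F : Vert m d → Vert m d := fun z => shift (E (need R z)) z with hF
    have hFinv : Function.Involutive F := by
      intro z
      rcases z with ⟨δ, a⟩ | ⟨w, ρ, i, j⟩ | t
      · simp [hF, shift, need, add_assoc, zmod2_add_self]
      · simp [hF, shift, need, add_assoc, pi_add_self]
      · rfl
    refine ⟨hFinv.toPerm F, fun a => ?_⟩
    have hFa : (hFinv.toPerm F) a = F a := rfl
    rw [hFa]
    obtain ⟨hadm, hcons, heq⟩ := hEspec a
    refine ⟨hpfin.insert _, (Set.ncard_insert_le _ _).trans (Nat.succ_le_of_lt hpK), E (need R a), ?_, ?_, ?_⟩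
    · rw [Need_insert, Finset.union_comm]; exact hadm
    · rw [Need_insert, Finset.union_comm]; exact hcons
    · rintro x (rfl | hx)
      · rfl
      · rw [hg.graph x hx]
        exact shift_congr R fun δ hδ => (heq δ (need_subset_Need R hx hδ)).symm

end strategy

end Literature.ModelTheory.FiniteModelTheory.TseitinColouring

/-! ## Size of the vertex set -/

namespace Literature.ModelTheory.FiniteModelTheory.TseitinColouring

open Finset Filter
open Literature.Computability.Complexity.Expander

/-- Vertices of `H(R, c)` per vertex of `R` (degree `d`). [folklore] -/
def per (d : ℕ) : ℕ := d * 2 + 2 ^ d * d * 3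

/-- The number of vertices of `H(R, c)`: `m · per d + 3`. [folklore] -/
theorem card_vert (m d : ℕ) : Fintype.card (Vert m d) = m * per d + 3 := by
  simp only [Fintype.card_sum, Fintype.card_prod, Fintype.card_fun, ZMod.card, Fintype.card_fin, per]
  ring

/-- `per d > 0` for `d ≥ 1`. [folklore] -/
theorem per_pos (d : ℕ) (hd : 1 ≤ d) : 0 < per d := by unfold per; positivity

end Literature.ModelTheory.FiniteModelTheory.TseitinColouring
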